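import Summits.AnomalousDissipation.AnomalousDissipation.Theorems.FloorCertificate.Negative.Uniform

/-!
# Disproof work file — crux `TaylorCertificates.FloorCertificate` (stmt-AnomalousDissipation-14091)

cdisprove seats `refuter-cdisprove-stmt-AnomalousDissipation-14091-0` (cycle 1, 2026-08-16) and
`refuter-cdisprove-stmt-AnomalousDissipation-14091-g2-0` (cycle 2, 2026-08-16).

THE CRUX. `∃ f` smooth solenoidal mean-zero, `∃ ε₀ ν₀ > 0`, `∀ ν ∈ (0, ν₀)`, `∃ Φ₁` cylindrical, `∃ θ₁ ≤ 0`,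
`∀ u ∈ H` of finite enstrophy in the Leray ball `|u|² ≤ 16‖f‖²/ν²`:
`ε₀ ≤ ν‖∇u‖² + ⟨F(u), Φ₁'(u)⟩ + 2θ₁((u,f) − ν‖∇u‖²)` (`FloorIneq ν f Φ₁ θ₁ ε₀ u`).

FINDINGS (index; cycle-1 content is LANDED under `Theorems/FloorCertificate/Negative/` and only indexed here;
cycle-2 content is in full below until it lands):
* §A–§B (landed, `Negative/WeakDuality.lean`, p74715): `floorCertificate_iff` (unbundling into `FloorFamily`),
  `floor_at_rest` (`ε₀ ≤ (f, Φ₁'(0))`), `floorFamily_force_ne_zero` (`f = 0` never a witness).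
* §C (landed, ibid.): WEAK DUALITY `floorFamily_le_ensembleDissipation` (every stationary statistical solution of
  `NS_ν(f)` is `ε₀`-loud), `floorFamily_le_dissipation_of_steady` (every steady weak solution `u ∈ V` has
  `ν‖∇u‖² ≥ ε₀`), `floorCertificate_steady_states_loud`; negative lemmas MODULO the open hypotheses
  `QuietStatistics` / `QuietSteadyStates` (`floorCertificate_false_of_quietStatistics`, `…_of_quietSteadyStates`).
* §D (landed, ibid.): `floor_at_quiet_euler_point` — at a smooth quiet Euler point of `f` the certificate pays only
  through `ν`: `ε₀ ≤ ν[(1 − 2θ₁)‖∇v‖² + (v, ΔΦ₁'(v))]` (a `1/ν` coercivity demand; affordable in this class).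
* §E (landed, `Negative/Uniform.lean` + `Negative/UniformTools.lean`, p76836/p75832): the ν-INDEPENDENT
  strengthening `FloorCertificateUniform` (one `(Φ₁, θ₁)` for all `ν`) is FALSE for every force
  (`not_floorCertificateUniform`, escaping frozen-multiplier beat).
* §F (NEW, cycle 2; in full below; landing as `Negative/{InjectedBeatTools,InjectedBeat,FixedResolution}.lean`):
  the BOUNDED-RESOLUTION strengthening `FloorCertificateFixedResolution` (test fields = trigonometric polynomials of
  a ν-independent degree `N`; profile `φ_ν`, number of fields and weight `θ₁(ν) ≤ 0` FREE) is FALSE for every force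
  (`not_floorCertificateFixedResolution`), by the INJECTED BEAT: a large single mode `σ f̂(k₀)` of the force makes
  the state energy-injecting (so the unbounded weight is signed away), and two waves outside the band beating at
  the largest coefficient of `Φ₁'(u₀)` with a FIXED amplitude kill the floor, gain and losses being both linear in
  the size of the multiplier. Quantitative core `floor_fails_at_fixed_resolution` (a threshold `ν₁(f, ε₀, N)` below
  which EVERY band-limited certificate fails) and `floor_witness_exceeds_resolution`.
* §F′ (NEW, cycle 2; in full below; landing as `Negative/{FixedMultiplierTools,FixedMultiplier}.lean`): the
  FROZEN-MULTIPLIER strengthening `FloorCertificateFixedMultiplier` (ONE cylindrical `Φ₁` with smooth fields of any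
  resolution chosen before `ν`; weight `θ₁(ν) ≤ 0` FREE) is FALSE for every force
  (`not_floorCertificateFixedMultiplier`): the injected mode of the force neutralises every weight, two waves
  escaping along a lattice ray beat at a mode of `Φ₁'(u₀)`, and the nine tail terms of the pair formula die by a
  WEIGHTED Riemann–Lebesgue lemma (`tendsto_tail`). Corollary `frozen_multiplier_fails`.
* §G (NEW) `witness_requirements` — everything a witness `(f, ε₀, ν₀, (Φ₁,θ₁)_ν)` of the crux must deliver,
  packaged: `f ≠ 0`; all steady states and all stationary statistics `ε₀`-loud for `ν < ν₀`; resolution of the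
  multipliers unbounded as `ν → 0` (for every `N`, below `ν₁(N)` every valid certificate has a test field of degree
  `> N`), whatever the weights; no multiplier reusable along any sequence `ν → 0`.
* §H (NEAR-MISS, sorried, NOT landed) `not_floorCertificateFixedFields` — fixed SMOOTH (non-polynomial) test
  fields with free PROFILE `φ_ν` and weight (the common generalisation of §F and §F′): paper proof by the injected
  beat plus an exact Gram correction of the cylindrical coordinates; obstruction = formalisation cost
  (finite-dimensional norm equivalence on `span{gᵢ}`), see docstring.
* §I WHY THE CRUX ITSELF RESISTS (prose, end of file): after §C/§E/§F/§F′ the certifier's only remaining resource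
  is a MOVING multiplier of RESOLUTION → ∞ (weights are worthless); `¬FloorCertificate` for every `f` is equivalent (mean-form strong
  duality, cards dissipation-deficit-duality / floor-minimax) to QUIET RELAXED STATIONARY STATISTICS for every
  force along `ν → 0` — the inverse-design / quiet-branch problem, open in 3-D; no ν-uniform kinematic adversary
  (baths, beats, phantoms, injected beats) reaches multipliers of unbounded resolution with unbounded weights.
-/

noncomputable section

set_option linter.dupNamespace false

open MeasureTheory UnitAddTorus Matrix Filter Topology
open scoped InnerProductSpace ENNReal ComplexConjugate

namespace Summit.AnomalousDissipation.AnomalousDissipation.Cruxes.FloorCertificate.Disproof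

open Literature.Analysis.FunctionSpaces Literature.Analysis.FluidPDE
open Summit.AnomalousDissipation.AnomalousDissipation.Theses.TaylorCertificates
open Summit.AnomalousDissipation.AnomalousDissipation.Theorems.TaylorCertificatePair.Negative
open Summit.AnomalousDissipation.AnomalousDissipation.Theorems.FloorCertificate.Negative
  (FloorIneq FloorFamily floorCertificate_iff floor_at_rest floorFamily_force_ne_zero
   floorFamily_le_ensembleDissipation floorFamily_le_dissipation_of_steady floorCertificate_steady_states_loud
   QuietStatistics QuietSteadyStates floorCertificate_false_of_quietStatistics
   floorCertificate_false_of_quietSteadyStates floor_at_quiet_euler_point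
   FloorCertificateUniform not_floorCertificateUniform
   -- cycle-1 tools (`Negative/UniformTools.lean`) used by §F′ below
   fc_grad_eq_sum integral_inner_grad_right norm_fc_grad_le norm_pi_mul_im_le
   tendsto_fc_ray tendsto_re_inner_fc_ray ray_dot ray_add_dot ray_ne_zero two_ray_ne_zero ray_add_ne_zero
   ray_sum_mul ray_add_sum_mul ray_self_sum ray_add_eq)

/-! ## §A–§E (cycle 1, LANDED): index by re-statement

The statements below are checked aliases of the landed theorems (see the module docstring for the files). -/

/-- §B (landed): the multiplier pushes against the force at rest. -/
example {ν : ℝ} (hν : 0 < ν) {f : (UnitAddTorus (Fin 3) → EuclideanSpace ℝ (Fin 3))} {Φ₁ : Torus.CylindricalTest (Fin 3)} {θ₁ ε₀ : ℝ}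
    (h : FloorIneq ν f Φ₁ θ₁ ε₀ 0) : ε₀ ≤ ∫ x, ⟪f x, Φ₁.grad 0 x⟫_ℝ :=
  floor_at_rest hν h

/-- §C (landed): weak duality — a floor family makes every stationary statistical solution `ε₀`-loud. -/
example {ν : ℝ} (hν : 0 < ν) {f : (UnitAddTorus (Fin 3) → EuclideanSpace ℝ (Fin 3))} (hf : MemLp f 2 volume) {ε₀ : ℝ}
    (hfl : FloorFamily f ε₀ ν) {μ : Measure (Torus.energySpace (Fin 3))} (hμ : Torus.IsStationaryStatisticalSolution ν f μ) :
    ε₀ ≤ Torus.ensembleDissipation ν μ :=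
  floorFamily_le_ensembleDissipation hν hf hfl hμ

/-- §C (landed): every steady weak solution is `ε₀`-loud under a floor family. -/
example {ν : ℝ} (hν : 0 < ν) {f : (UnitAddTorus (Fin 3) → EuclideanSpace ℝ (Fin 3))} (hf : MemLp f 2 volume) {ε₀ : ℝ}
    (hfl : FloorFamily f ε₀ ν) {u : (Torus.energySpace (Fin 3))}
    (hV : (u : (Lp (EuclideanSpace ℝ (Fin 3)) 2 (volume : Measure (UnitAddTorus (Fin 3))))) ∈ Torus.energySpaceV (Fin 3))
    (hu : Torus.IsSteadyWeakSolution ν f u) :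
    ε₀ ≤ ν * (Torus.eGradNormSq ((u : (Lp (EuclideanSpace ℝ (Fin 3)) 2 (volume : Measure (UnitAddTorus (Fin 3))))) : (UnitAddTorus (Fin 3) → EuclideanSpace ℝ (Fin 3)))).toReal :=
  floorFamily_le_dissipation_of_steady hν hf hfl hV hu

/-- §C (landed): negative lemmas modulo the OPEN hypotheses (quiet statistics / quiet steady branch for every force). -/
example : QuietStatistics → ¬ FloorCertificate := floorCertificate_false_of_quietStatistics
example : QuietSteadyStates → ¬ FloorCertificate := floorCertificate_false_of_quietSteadyStates

/-- §E (landed): no ν-independent certificate exists, for any force. -/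
example : ¬ FloorCertificateUniform := not_floorCertificateUniform

/-! ## §F (cycle 2, NEW): no floor certificate of BOUNDED RESOLUTION exists, for any force, whatever the weight

Witness (injected beat). Let `ĉ = f̂(k₀) ≠ 0` be a Fourier mode of the force and `u₀ = Re(e_{k₀} σĉ)` the
corresponding single mode with a LARGE amplitude `σ` (energy input `(u₀, f) = σ‖ĉ‖² = 2α‖f‖₂ + 2`). Given `ν`,
`Φ₁` (test fields of degree `≤ N`) and `θ₁ ≤ 0`, put `W := Φ₁'(u₀)` and `𝔊² := ∑_{|κ|≤N} ‖Ŵ(κ)‖²`. If `𝔊 = 0`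
the floor at `u₀` reads `ε₀ ≤ ν‖∇u₀‖²` (no self-interaction; injection signs the weight away). Otherwise let `q`
maximise `‖Ŵ(κ)‖` over the ball, take the integer frame `r ⊥ q`, the real unit `B ⊥ r, q` with
`2|ζ|² ≥ ‖Ŵ(q)‖²` and two waves at `p = t r`, `p + q` outside the band (`wave_frequencies_gen`), polarised
`(α/|q|) q`, `ω α B` with a FIXED amplitude `α`, `πα² = (‖f‖₂ + 2)√(2 #ball)`. The waves are invisible to the
test fields (`Φ₁'(u₀ + waves) = W`); only the `(p, p+q)` beat at `q` survives (`inertial_beat_gen`) and is worth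
`≤ −(‖f‖₂ + 2)𝔊`, while `(f, W) ≤ ‖f‖₂ 𝔊` and `ν(u, ΔW) ≤ 𝔊`; the energy input `≥ 2` exceeds the dissipation
`≤ 1`, so the weight term is `≤ 0` for EVERY `θ₁ ≤ 0`: the floor reads `ε₀ ≤ ν‖∇u‖² − 𝔊 ≤ ε₀/2`. All smallness
conditions on `ν` are upper bounds depending on `(f, ε₀, N)` only. -/

/-! ### §F.1 Lattice geometry: wave frequencies far from the band and from the injected mode -/

/-- `(X + 4)² + N² ≤ (X + 5)²` when `N² ≤ X`, `0 ≤ X`. -/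
theorem numeric_bound_gen {X n : ℝ} (hX : 0 ≤ X) (hn : n ≤ X) : (X + 4) ^ 2 + n ≤ (X + 5) ^ 2 := by
  nlinarith

/-- **Wave frequencies (general injected mode).** Given the beat frequency `q` in the ball of radius `N`,
a lattice direction `r ⊥ q` of length `≤ |q|²` and a bound `K ≥ 1` on `|k₀|²`, there is a multiple `p`
of `r` with `p ⊥ q` such that `p`, `p + q`, `p ± k₀`, `p + q ± k₀`, `2p + q` lie outside the ball, while
`|p|², |p + q|² ≤ (N² + 2N + 2K + 5)²`. -/
theorem wave_frequencies_gen (N : ℕ) {q r k₀ : Fin 3 → ℤ} (hqN : Torus.freqNormSq q ≤ (N : ℝ) ^ 2)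
    (hr : r ≠ 0) (hrq : r ⬝ᵥ q = 0) (hrq2 : Torus.freqNormSq r ≤ Torus.freqNormSq q ^ 2)
    {K : ℕ} (hK1 : 1 ≤ K) (hk₀ : Torus.freqNormSq k₀ ≤ (K : ℝ)) :
    ∃ (t : ℕ) (p : Fin 3 → ℤ), p = (fun i => (t : ℤ) * r i) ∧ p ⬝ᵥ q = 0 ∧
      (N : ℝ) ^ 2 < Torus.freqNormSq p ∧ (N : ℝ) ^ 2 < Torus.freqNormSq (p + q) ∧
      (N : ℝ) ^ 2 < Torus.freqNormSq (p + k₀) ∧ (N : ℝ) ^ 2 < Torus.freqNormSq (p - k₀) ∧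
      (N : ℝ) ^ 2 < Torus.freqNormSq (p + q + k₀) ∧ (N : ℝ) ^ 2 < Torus.freqNormSq (p + q - k₀) ∧
      (N : ℝ) ^ 2 < Torus.freqNormSq (p + (p + q)) ∧
      Torus.freqNormSq p ≤ ((N ^ 2 + 2 * N + 2 * K + 5 : ℕ) : ℝ) ^ 2 ∧
      Torus.freqNormSq (p + q) ≤ ((N ^ 2 + 2 * N + 2 * K + 5 : ℕ) : ℝ) ^ 2 := by
  have hR1 : 1 ≤ Torus.freqNormSq r := Torus.one_le_freqNormSq_of_ne_zero hr
  have hRpos : 0 < Torus.freqNormSq r := lt_of_lt_of_le one_pos hR1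
  have hsq : 0 < Real.sqrt (Torus.freqNormSq r) := Real.sqrt_pos.2 hRpos
  have hK1' : (1 : ℝ) ≤ K := by exact_mod_cast hK1
  let t : ℕ := ⌈(2 * (N : ℝ) + 2 * K + 4) / Real.sqrt (Torus.freqNormSq r)⌉₊
  let p : Fin 3 → ℤ := fun i => (t : ℤ) * r i
  have hpq : p ⬝ᵥ q = 0 := by
    show (fun i => (t : ℤ) * r i) ⬝ᵥ q = 0
    rw [natMul_dot, hrq, mul_zero]
  have hpn : Torus.freqNormSq p = ((t : ℝ) * Real.sqrt (Torus.freqNormSq r)) ^ 2 := by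
    show Torus.freqNormSq (fun i => (t : ℤ) * r i) = _
    rw [freqNormSq_natMul, mul_pow, Real.sq_sqrt hRpos.le]
  -- lower bound: `2N + 2K + 4 ≤ |p|`
  have hlow' : 2 * (N : ℝ) + 2 * K + 4 ≤ (t : ℝ) * Real.sqrt (Torus.freqNormSq r) := by
    have ht1 : (2 * (N : ℝ) + 2 * K + 4) / Real.sqrt (Torus.freqNormSq r) ≤ t := Nat.le_ceil _
    rwa [div_le_iff₀ hsq] at ht1
  have hN0 : (0 : ℝ) ≤ N := Nat.cast_nonneg N
  have hlow : (2 * (N : ℝ) + 2 * K + 4) ^ 2 ≤ Torus.freqNormSq p := by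
    rw [hpn]
    exact numeric_sq_mono (by positivity) hlow'
  -- upper bound: `|p| < 2N + 2K + 4 + |r| ≤ N² + 2N + 2K + 4`
  have hsqrt_le : Real.sqrt (Torus.freqNormSq r) ≤ (N : ℝ) ^ 2 := by
    calc Real.sqrt (Torus.freqNormSq r) ≤ Real.sqrt (Torus.freqNormSq q ^ 2) :=
          Real.sqrt_le_sqrt hrq2
      _ = Torus.freqNormSq q := Real.sqrt_sq (Torus.freqNormSq_nonneg q)
      _ ≤ (N : ℝ) ^ 2 := hqN
  have hup : Torus.freqNormSq p ≤ ((N : ℝ) ^ 2 + 2 * N + 2 * K + 4) ^ 2 := by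
    have ht2 : (t : ℝ) < (2 * (N : ℝ) + 2 * K + 4) / Real.sqrt (Torus.freqNormSq r) + 1 :=
      Nat.ceil_lt_add_one (by positivity)
    have hup' : (t : ℝ) * Real.sqrt (Torus.freqNormSq r) <
        2 * (N : ℝ) + 2 * K + 4 + Real.sqrt (Torus.freqNormSq r) := by
      have := mul_lt_mul_of_pos_right ht2 hsq
      rwa [add_mul, one_mul, div_mul_cancel₀ _ hsq.ne'] at this
    rw [hpn]
    exact numeric_sq_mono (by positivity) (by linarith)
  have hpq_norm : Torus.freqNormSq (p + q) = Torus.freqNormSq p + Torus.freqNormSq q :=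
    freqNormSq_add_of_dot_eq_zero p q hpq
  have hq0 : 0 ≤ Torus.freqNormSq q := Torus.freqNormSq_nonneg q
  have hk0 : 0 ≤ Torus.freqNormSq k₀ := Torus.freqNormSq_nonneg k₀
  have hmk : Torus.freqNormSq (-k₀) = Torus.freqNormSq k₀ := Torus.freqNormSq_neg k₀
  -- parallelogram lower bounds
  have P1 := freqNormSq_le_two_mul p k₀
  have P2 := freqNormSq_le_two_mul p (-k₀)
  have P3 := freqNormSq_le_two_mul (p + q) k₀
  have P4 := freqNormSq_le_two_mul (p + q) (-k₀)
  rw [hmk, ← sub_eq_add_neg] at P2 P4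
  rw [hpq_norm] at P3 P4
  have hpp : Torus.freqNormSq (p + (p + q)) =
      Torus.freqNormSq p + Torus.freqNormSq (p + q) + 2 * ((fun i => ((p) i : ℝ)) ⬝ᵥ (fun i => (((p + q)) i : ℝ))) :=
    freqNormSq_add_self_dot p (p + q)
  have hdot : (fun i => ((p) i : ℝ)) ⬝ᵥ (fun i => (((p + q)) i : ℝ)) = Torus.freqNormSq p := by
    rw [castR_add, dotProduct_add, ← freqNormSq_eq_castR_dot, castR_dot, hpq]; simp
  rw [hdot, hpq_norm] at hpp
  have hcast : (((N ^ 2 + 2 * N + 2 * K + 5 : ℕ) : ℝ)) = (N : ℝ) ^ 2 + 2 * N + 2 * K + 5 := by push_cast; ring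
  have hX : (0 : ℝ) ≤ (N : ℝ) ^ 2 + 2 * N + 2 * K := by positivity
  have hnX : Torus.freqNormSq q ≤ (N : ℝ) ^ 2 + 2 * N + 2 * K := by linarith
  have hnum := numeric_bound_gen hX hnX
  -- `|p|²` dominates everything in sight
  have hbig : 2 * (N : ℝ) ^ 2 + 2 * K + 2 ≤ Torus.freqNormSq p := by
    have h1 : 2 * (N : ℝ) ^ 2 + 2 * K + 2 ≤ (2 * (N : ℝ) + 2 * K + 4) ^ 2 := by nlinarith
    linarith
  have h45 : ((N : ℝ) ^ 2 + 2 * N + 2 * K + 4) ^ 2 ≤ ((N : ℝ) ^ 2 + 2 * N + 2 * K + 5) ^ 2 := by nlinarith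
  refine ⟨t, p, rfl, hpq, ?_, ?_, ?_, ?_, ?_, ?_, ?_, ?_, ?_⟩
  · linarith
  · rw [hpq_norm]; linarith
  · linarith
  · linarith
  · linarith
  · linarith
  · rw [hpp]; linarith
  · rw [hcast]; linarith
  · rw [hcast, hpq_norm]; linarith

/-! ### §F.2 Exact inertial evaluations for a general injected mode -/

/-- Inertial term of a single transversal mode against any smooth field: zero (no self-interaction). -/
theorem inertial_mode_zero {G : (UnitAddTorus (Fin 3)) → (EuclideanSpace ℝ (Fin 3))} (hG : Torus.IsSmooth G)
    (k₀ : Fin 3 → ℤ) (zs : (EuclideanSpace ℂ (Fin 3))) (hs : ((fun j => ((k₀) j : ℂ)) ⬝ᵥ (WithLp.ofLp (zs))) = 0) :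
    ∫ x, ⟪Torus.fderiv G x ((∑ mm, Torus.realTrigPoly {![k₀] mm} (fun _ => ![zs] mm)) x),
      (∑ mm, Torus.realTrigPoly {![k₀] mm} (fun _ => ![zs] mm)) x⟫_ℝ = 0 := by
  rw [inertial_modes hG]
  have d00 : ((fun j => (((k₀ + k₀)) j : ℂ)) ⬝ᵥ (WithLp.ofLp (zs))) = 0 := by rw [dotc_add_left, hs, add_zero]
  simp only [Fin.sum_univ_one, Matrix.cons_val_fin_one, sub_self, dotc_zero_left,
    d00, zero_mul, mul_zero, map_zero, Complex.zero_im, add_zero]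

set_option maxHeartbeats 1000000 in
/-- **The injected beat.** Inertial term of a transversal mode at `k₀` plus two transversal waves at `p`,
`p + q` against a smooth `G` whose coefficients vanish at `k₀ ± p`, `k₀ ± (p+q)` (up to sign), `2p + q`
and `0`, and whose coefficient at `-q` is orthogonal to `zA`: only the `(p, p+q)` BEAT at `q` survives. -/
theorem inertial_beat_gen {G : (UnitAddTorus (Fin 3)) → (EuclideanSpace ℝ (Fin 3))} (hG : Torus.IsSmooth G)
    (k₀ p q : Fin 3 → ℤ) (zs zA zB : (EuclideanSpace ℂ (Fin 3)))
    (hs : ((fun j => ((k₀) j : ℂ)) ⬝ᵥ (WithLp.ofLp (zs))) = 0)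
    (hA : ((fun j => ((p) j : ℂ)) ⬝ᵥ (WithLp.ofLp (zA))) = 0)
    (hB : ((fun j => (((p + q)) j : ℂ)) ⬝ᵥ (WithLp.ofLp (zB))) = 0)
    (h1 : (mFourierCoeff (EuclideanSpace.complexify ∘ G) (k₀ + p)) = 0)
    (h2 : (mFourierCoeff (EuclideanSpace.complexify ∘ G) (p - k₀)) = 0)
    (h3 : (mFourierCoeff (EuclideanSpace.complexify ∘ G) (p + k₀)) = 0)
    (h4 : (mFourierCoeff (EuclideanSpace.complexify ∘ G) (k₀ - p)) = 0)
    (h5 : (mFourierCoeff (EuclideanSpace.complexify ∘ G) (k₀ + (p + q))) = 0)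
    (h6 : (mFourierCoeff (EuclideanSpace.complexify ∘ G) ((p + q) - k₀)) = 0)
    (h7 : (mFourierCoeff (EuclideanSpace.complexify ∘ G) ((p + q) + k₀)) = 0)
    (h8 : (mFourierCoeff (EuclideanSpace.complexify ∘ G) (k₀ - (p + q))) = 0)
    (h9 : (mFourierCoeff (EuclideanSpace.complexify ∘ G) (p + (p + q))) = 0)
    (h10 : (mFourierCoeff (EuclideanSpace.complexify ∘ G) ((p + q) + p)) = 0)
    (hAq : ⟪(mFourierCoeff (EuclideanSpace.complexify ∘ G) (-q)), zA⟫_ℂ = 0) :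
    ∫ x, ⟪Torus.fderiv G x ((∑ mm, Torus.realTrigPoly {![k₀, p, p + q] mm} (fun _ => ![zs, zA, zB] mm)) x),
        (∑ mm, Torus.realTrigPoly {![k₀, p, p + q] mm} (fun _ => ![zs, zA, zB] mm)) x⟫_ℝ =
      Real.pi * (conj (((fun j => ((q) j : ℂ)) ⬝ᵥ (WithLp.ofLp (zA)))) * ⟪(mFourierCoeff (EuclideanSpace.complexify ∘ G) q), zB⟫_ℂ).im := by
  rw [inertial_modes hG]
  have e1 : p + q - p = q := add_sub_cancel_left p q
  have e2' : p - (p + q) = -q := by abel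
  have d00 : ((fun j => (((k₀ + k₀)) j : ℂ)) ⬝ᵥ (WithLp.ofLp (zs))) = 0 := by rw [dotc_add_left, hs, add_zero]
  have d11 : ((fun j => (((p + p)) j : ℂ)) ⬝ᵥ (WithLp.ofLp (zA))) = 0 := by rw [dotc_add_left, hA, add_zero]
  have d22 : ((fun j => (((p + q + (p + q))) j : ℂ)) ⬝ᵥ (WithLp.ofLp (zB))) = 0 := by rw [dotc_add_left, hB, add_zero]
  have hA2 : ((fun j => (((p + q - p)) j : ℂ)) ⬝ᵥ (WithLp.ofLp (zA))) = ((fun j => ((q) j : ℂ)) ⬝ᵥ (WithLp.ofLp (zA))) := by rw [e1]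
  simp only [Fin.sum_univ_three, Matrix.cons_val_zero, Matrix.cons_val_one, Matrix.cons_val_two,
    Matrix.head_cons, Matrix.tail_cons, sub_self, dotc_zero_left, d00, d11, d22, hA2, e2',
    h1, h2, h3, h4, h5, h6, h7, h8, h9, h10, hAq, zero_mul, mul_zero, map_zero,
    inner_zero_left, Complex.zero_im, add_zero, zero_add]
  rw [e1]

/-! ### §F.3 Invisibility of the waves; the Laplacian pairing -/

/-- The coordinates of the injected beat state and of the injected mode agree: the waves outside the band
are invisible to the band-limited test fields. -/
theorem coords_waves_invisible (Φ : Torus.CylindricalTest (Fin 3)) {N : ℕ}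
    (hΦ : ∀ i, Torus.fourierTruncate N (Φ.g i) = Φ.g i) {k₀ p q : Fin 3 → ℤ} {zs zA zB : (EuclideanSpace ℂ (Fin 3))}
    (hNp : (N : ℝ) ^ 2 < Torus.freqNormSq p) (hNpq : (N : ℝ) ^ 2 < Torus.freqNormSq (p + q))
    {uw ue : (Torus.energySpace (Fin 3))}
    (huw : (((uw : (Torus.energySpace (Fin 3))) : (Lp (EuclideanSpace ℝ (Fin 3)) 2 (volume : Measure (UnitAddTorus (Fin 3))))) : (UnitAddTorus (Fin 3)) → (EuclideanSpace ℝ (Fin 3))) =ᵐ[volume] (∑ mm, Torus.realTrigPoly {![k₀, p, p + q] mm} (fun _ => ![zs, zA, zB] mm)))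
    (hue : (((ue : (Torus.energySpace (Fin 3))) : (Lp (EuclideanSpace ℝ (Fin 3)) 2 (volume : Measure (UnitAddTorus (Fin 3))))) : (UnitAddTorus (Fin 3)) → (EuclideanSpace ℝ (Fin 3))) =ᵐ[volume] (∑ mm, Torus.realTrigPoly {![k₀] mm} (fun _ => ![zs] mm))) :
    Φ.coords uw = Φ.coords ue := by
  ext i
  rw [coords_of_ae huw, coords_of_ae hue, integral_inner_modes_left (Φ.g_smooth i).integrable,
    integral_inner_modes_left (Φ.g_smooth i).integrable]
  simp only [Fin.sum_univ_three, Fin.sum_univ_one, Matrix.cons_val_zero, Matrix.cons_val_one,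
    Matrix.cons_val_two, Matrix.head_cons, Matrix.tail_cons, Fin.isValue, Matrix.cons_val_fin_one]
  rw [fc_g_eq_zero Φ hΦ i p hNp, fc_g_eq_zero Φ hΦ i (p + q) hNpq, inner_zero_right, inner_zero_right,
    Complex.zero_re, add_zero, add_zero]

/-- One Laplacian term in Fourier variables at a general frequency, bounded by the truncated norm:
`|Re⟪z, −4π²|k₀|² Ĝ(k₀)⟫| ≤ ‖z‖ · 4π²|k₀|² · 𝔊`. -/
theorem laplacian_coeff_le {G : (UnitAddTorus (Fin 3)) → (EuclideanSpace ℝ (Fin 3))} {N : ℕ}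
    (hband : ∀ κ, (N : ℝ) ^ 2 < Torus.freqNormSq κ → mFourierCoeff (EuclideanSpace.complexify ∘ G) κ = 0)
    (k₀ : Fin 3 → ℤ) (zs : (EuclideanSpace ℂ (Fin 3))) :
    |(⟪zs, -(((4 * Real.pi ^ 2 * Torus.freqNormSq k₀ : ℝ) : ℂ) • (mFourierCoeff (EuclideanSpace.complexify ∘ G) k₀))⟫_ℂ).re| ≤
      ‖zs‖ * (4 * Real.pi ^ 2 * Torus.freqNormSq k₀) * (Real.sqrt (∑ κ' ∈ Torus.freqBall N, ‖mFourierCoeff (EuclideanSpace.complexify ∘ G) κ'‖ ^ 2)) := by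
  refine (abs_re_inner_le_norm_mul _ _).trans ?_
  have h4 : (0 : ℝ) ≤ 4 * Real.pi ^ 2 * Torus.freqNormSq k₀ := by
    have := Torus.freqNormSq_nonneg k₀
    positivity
  rw [norm_neg, norm_smul, Complex.norm_real, Real.norm_of_nonneg h4]
  have h := norm_fc_le_coeffNorm hband k₀
  have hz := norm_nonneg zs
  calc ‖zs‖ * (4 * Real.pi ^ 2 * Torus.freqNormSq k₀ * ‖(mFourierCoeff (EuclideanSpace.complexify ∘ G) k₀)‖)
      = (‖zs‖ * (4 * Real.pi ^ 2 * Torus.freqNormSq k₀)) * ‖(mFourierCoeff (EuclideanSpace.complexify ∘ G) k₀)‖ := by ring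
    _ ≤ (‖zs‖ * (4 * Real.pi ^ 2 * Torus.freqNormSq k₀)) * (Real.sqrt (∑ κ' ∈ Torus.freqBall N, ‖mFourierCoeff (EuclideanSpace.complexify ∘ G) κ'‖ ^ 2)) :=
        mul_le_mul_of_nonneg_left h (mul_nonneg hz h4)

/-- The Laplacian pairing of the injected mode. -/
theorem laplacian_one_le {G : (UnitAddTorus (Fin 3)) → (EuclideanSpace ℝ (Fin 3))} (hG : Torus.IsSmooth G) {N : ℕ}
    (hband : ∀ κ, (N : ℝ) ^ 2 < Torus.freqNormSq κ → mFourierCoeff (EuclideanSpace.complexify ∘ G) κ = 0)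
    (k₀ : Fin 3 → ℤ) (zs : (EuclideanSpace ℂ (Fin 3))) :
    |∫ x, ⟪(∑ mm, Torus.realTrigPoly {![k₀] mm} (fun _ => ![zs] mm)) x, Torus.laplacian G x⟫_ℝ| ≤
      ‖zs‖ * (4 * Real.pi ^ 2 * Torus.freqNormSq k₀) * (Real.sqrt (∑ κ' ∈ Torus.freqBall N, ‖mFourierCoeff (EuclideanSpace.complexify ∘ G) κ'‖ ^ 2)) := by
  rw [integral_inner_modes_laplacian hG]
  simp only [Fin.sum_univ_one, Matrix.cons_val_fin_one]
  exact laplacian_coeff_le hband k₀ zs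

/-- The Laplacian pairing of the injected beat state: the two waves outside the band do not contribute. -/
theorem laplacian_three_le {G : (UnitAddTorus (Fin 3)) → (EuclideanSpace ℝ (Fin 3))} (hG : Torus.IsSmooth G) {N : ℕ}
    (hband : ∀ κ, (N : ℝ) ^ 2 < Torus.freqNormSq κ → mFourierCoeff (EuclideanSpace.complexify ∘ G) κ = 0)
    (k₀ : Fin 3 → ℤ) (zs zA zB : (EuclideanSpace ℂ (Fin 3))) {p q : Fin 3 → ℤ}
    (hp : (mFourierCoeff (EuclideanSpace.complexify ∘ G) p) = 0) (hpq : (mFourierCoeff (EuclideanSpace.complexify ∘ G) (p + q)) = 0) :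
    |∫ x, ⟪(∑ mm, Torus.realTrigPoly {![k₀, p, p + q] mm} (fun _ => ![zs, zA, zB] mm)) x, Torus.laplacian G x⟫_ℝ| ≤
      ‖zs‖ * (4 * Real.pi ^ 2 * Torus.freqNormSq k₀) * (Real.sqrt (∑ κ' ∈ Torus.freqBall N, ‖mFourierCoeff (EuclideanSpace.complexify ∘ G) κ'‖ ^ 2)) := by
  rw [integral_inner_modes_laplacian hG]
  simp only [Fin.sum_univ_three, Matrix.cons_val_zero, Matrix.cons_val_one, Matrix.cons_val_two,
    Matrix.head_cons, Matrix.tail_cons, hp, hpq, smul_zero, neg_zero, inner_zero_right,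
    Complex.zero_re, add_zero, Fin.isValue]
  exact laplacian_coeff_le hband k₀ zs

/-! ### §F.4 The injected mode of the force -/

/-- A smooth mean-zero field with positive energy has a nonzero Fourier mode at a nonzero frequency. -/
theorem exists_fc_ne_zero_of_force {f : (UnitAddTorus (Fin 3)) → (EuclideanSpace ℝ (Fin 3))} (hf : Torus.IsSmooth f)
    (hmean : Torus.HasZeroMean f) (hpos : 0 < ∫ x, ‖f x‖ ^ 2) :
    ∃ k₀ : Fin 3 → ℤ, k₀ ≠ 0 ∧ mFourierCoeff (EuclideanSpace.complexify ∘ f) k₀ ≠ 0 := by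
  by_contra h
  push Not at h
  have hall : ∀ κ, mFourierCoeff (EuclideanSpace.complexify ∘ f) κ = 0 := by
    intro κ
    by_cases hκ : κ = 0
    · rw [hκ]; exact Torus.mFourierCoeff_complexify_zero_of_hasZeroMean hf.integrable hmean
    · exact h κ hκ
  have hzero : (EuclideanSpace.complexify ∘ f) = 0 :=
    Torus.eq_zero_of_forall_mFourierCoeff_eq_zero hf.complexify_comp.continuous hall
  have hf0 : ∀ x, f x = 0 := by
    intro x
    have hx := congrFun hzero x
    simp only [Function.comp_apply, Pi.zero_apply] at hx
    have hn : ‖f x‖ = 0 := by rw [← EuclideanSpace.norm_complexify, hx, norm_zero]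
    exact norm_eq_zero.1 hn
  have : (∫ x, ‖f x‖ ^ 2) = 0 := by simp [hf0]
  linarith

/-- The energy input of the injected mode: `(Re(e_{k₀} σ ĉ), f) = σ ‖ĉ‖²` for `ĉ = f̂(k₀)`. -/
theorem injection_value {f : (UnitAddTorus (Fin 3)) → (EuclideanSpace ℝ (Fin 3))} (k₀ : Fin 3 → ℤ) (σ : ℝ) :
    (⟪((σ : ℂ) • mFourierCoeff (EuclideanSpace.complexify ∘ f) k₀), mFourierCoeff (EuclideanSpace.complexify ∘ f) k₀⟫_ℂ).re =
      σ * ‖mFourierCoeff (EuclideanSpace.complexify ∘ f) k₀‖ ^ 2 := by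
  rw [inner_smul_left, Complex.conj_ofReal, Complex.re_ofReal_mul]
  congr 1
  have h := inner_self_eq_norm_sq (𝕜 := ℂ) (mFourierCoeff (EuclideanSpace.complexify ∘ f) k₀)
  simpa using h

/-- Norm of the injected polarisation `σ ĉ`: `‖σ ĉ‖ = σ ‖ĉ‖` for `σ ≥ 0`. -/
theorem norm_injected {σ : ℝ} (hσ : 0 ≤ σ) (c : (EuclideanSpace ℂ (Fin 3))) : ‖((σ : ℂ) • c)‖ = σ * ‖c‖ := by
  rw [norm_smul, Complex.norm_real, Real.norm_of_nonneg hσ]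

/-- Transversality of the injected polarisation: `k₀ · (σ ĉ) = 0` for a solenoidal `f`. -/
theorem dotc_injected {f : (UnitAddTorus (Fin 3)) → (EuclideanSpace ℝ (Fin 3))} (hf : Torus.IsSmooth f) (hdiv : Torus.IsDivFree f)
    (k₀ : Fin 3 → ℤ) (σ : ℝ) :
    ((fun j => ((k₀) j : ℂ)) ⬝ᵥ (WithLp.ofLp (((σ : ℂ) • mFourierCoeff (EuclideanSpace.complexify ∘ f) k₀)))) = 0 := by
  rw [dotc_smul]
  have h : ((fun j => ((k₀) j : ℂ)) ⬝ᵥ (WithLp.ofLp ((mFourierCoeff (EuclideanSpace.complexify ∘ f) k₀)))) = 0 :=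
    hdiv.sum_mul_mFourierCoeff_eq_zero hf k₀
  rw [h, mul_zero]

/-! ### §F.5 Membership facts for the mode vectors -/

/-- The injected frequency vector has nonzero entries. -/
theorem one_ne_zero_gen {k₀ : Fin 3 → ℤ} (hk₀ : k₀ ≠ 0) : ∀ m, (![k₀] : Fin 1 → (Fin 3 → ℤ)) m ≠ 0 := by
  intro m; fin_cases m; exact hk₀

/-- Transversality of the injected polarisation vector. -/
theorem one_dotc_gen {k₀ : Fin 3 → ℤ} {z₀ : (EuclideanSpace ℂ (Fin 3))} (h0 : ((fun j => ((k₀) j : ℂ)) ⬝ᵥ (WithLp.ofLp (z₀))) = 0) :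
    ∀ m, ((fun j => ((((![k₀] : Fin 1 → (Fin 3 → ℤ)) m)) j : ℂ)) ⬝ᵥ (WithLp.ofLp (((![z₀] : Fin 1 → (EuclideanSpace ℂ (Fin 3))) m)))) = 0 := by
  intro m; fin_cases m; exact h0

/-- The injected frequency lies in the ball of radius `L` once `|k₀|² ≤ L²`. -/
theorem one_freq_le_gen {k₀ : Fin 3 → ℤ} {L : ℕ} (hk : Torus.freqNormSq k₀ ≤ (L : ℝ) ^ 2) :
    ∀ m, Torus.freqNormSq ((![k₀] : Fin 1 → (Fin 3 → ℤ)) m) ≤ (L : ℝ) ^ 2 := by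
  intro m; fin_cases m; exact hk

/-- The three frequencies of the injected beat state are nonzero. -/
theorem three_ne_zero_gen {k₀ p q : Fin 3 → ℤ} (hk₀ : k₀ ≠ 0) (hp : p ≠ 0) (hpq : p + q ≠ 0) :
    ∀ m, (![k₀, p, p + q] : Fin 3 → (Fin 3 → ℤ)) m ≠ 0 := by
  intro m
  fin_cases m
  · exact hk₀
  · exact hp
  · exact hpq

/-- Transversality of the three polarisations of the injected beat state. -/
theorem three_dotc_gen {k₀ p q : Fin 3 → ℤ} {z₀ zA zB : (EuclideanSpace ℂ (Fin 3))}
    (h0 : ((fun j => ((k₀) j : ℂ)) ⬝ᵥ (WithLp.ofLp (z₀))) = 0)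
    (hA : ((fun j => ((p) j : ℂ)) ⬝ᵥ (WithLp.ofLp (zA))) = 0)
    (hB : ((fun j => (((p + q)) j : ℂ)) ⬝ᵥ (WithLp.ofLp (zB))) = 0) :
    ∀ m, ((fun j => ((((![k₀, p, p + q] : Fin 3 → (Fin 3 → ℤ)) m)) j : ℂ)) ⬝ᵥ (WithLp.ofLp (((![z₀, zA, zB] : Fin 3 → (EuclideanSpace ℂ (Fin 3))) m)))) = 0 := by
  intro m
  fin_cases m
  · exact h0
  · exact hA
  · exact hB

/-- The three frequencies of the injected beat state lie in the ball of radius `L`. -/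
theorem three_freq_le_gen {k₀ p q : Fin 3 → ℤ} {L : ℕ} (hk : Torus.freqNormSq k₀ ≤ (L : ℝ) ^ 2)
    (hp : Torus.freqNormSq p ≤ (L : ℝ) ^ 2) (hpq : Torus.freqNormSq (p + q) ≤ (L : ℝ) ^ 2) :
    ∀ m, Torus.freqNormSq ((![k₀, p, p + q] : Fin 3 → (Fin 3 → ℤ)) m) ≤ (L : ℝ) ^ 2 := by
  intro m
  fin_cases m
  · exact hk
  · exact hp
  · exact hpq

/-! ### §F.6 The FLOOR at the injected mode and at the injected beat state -/

/-- **FLOOR at the injected mode.** If the floor holds at the single transversal mode `Re(e_{k₀} z₀)`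
whose energy input dominates its dissipation, then
`ε₀ ≤ ν‖∇u₀‖² + ‖f‖₂ 𝔊 + ν ‖z₀‖ 4π²|k₀|² 𝔊` (`𝔊` the truncated coefficient norm of `Φ'(u₀)`):
no self-interaction, and the weight term is signed away by the injection. -/
theorem floor_at_mode {f : (UnitAddTorus (Fin 3)) → (EuclideanSpace ℝ (Fin 3))} (hf : Torus.IsSmooth f) {ν : ℝ} (hν : 0 < ν)
    (Φ : Torus.CylindricalTest (Fin 3)) {N : ℕ} (hΦ : ∀ i, Torus.fourierTruncate N (Φ.g i) = Φ.g i)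
    {θ ε₀ : ℝ} (hθ : θ ≤ 0) {k₀ : Fin 3 → ℤ} {z₀ : (EuclideanSpace ℂ (Fin 3))}
    (hdz : ((fun j => ((k₀) j : ℂ)) ⬝ᵥ (WithLp.ofLp (z₀))) = 0)
    (ue : (Torus.energySpace (Fin 3)))
    (hue : (((ue : (Torus.energySpace (Fin 3))) : (Lp (EuclideanSpace ℝ (Fin 3)) 2 (volume : Measure (UnitAddTorus (Fin 3))))) : (UnitAddTorus (Fin 3)) → (EuclideanSpace ℝ (Fin 3))) =ᵐ[volume] (∑ mm, Torus.realTrigPoly {![k₀] mm} (fun _ => ![z₀] mm)))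
    (hball : ∫ x, ‖(∑ mm, Torus.realTrigPoly {![k₀] mm} (fun _ => ![z₀] mm)) x‖ ^ 2 ≤ 16 * (∫ x, ‖f x‖ ^ 2) / ν ^ 2)
    (hD : ν * (Torus.eGradNormSq ((∑ mm, Torus.realTrigPoly {![k₀] mm} (fun _ => ![z₀] mm)))).toReal ≤
      (⟪z₀, mFourierCoeff (EuclideanSpace.complexify ∘ f) k₀⟫_ℂ).re)
    (hfl : FloorIneq ν f Φ θ ε₀ ue) :
    ε₀ ≤ ν * (Torus.eGradNormSq ((∑ mm, Torus.realTrigPoly {![k₀] mm} (fun _ => ![z₀] mm)))).toReal +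
      Real.sqrt (∫ x, ‖f x‖ ^ 2) * (Real.sqrt (∑ κ' ∈ Torus.freqBall N, ‖mFourierCoeff (EuclideanSpace.complexify ∘ (Φ.grad ue)) κ'‖ ^ 2)) +
      ν * (‖z₀‖ * (4 * Real.pi ^ 2 * Torus.freqNormSq k₀) * (Real.sqrt (∑ κ' ∈ Torus.freqBall N, ‖mFourierCoeff (EuclideanSpace.complexify ∘ (Φ.grad ue)) κ'‖ ^ 2))) := by
  set G := Φ.grad ue with hGdef
  have hG : Torus.IsSmooth G := isSmooth_grad Φ ue
  have hband : ∀ κ, (N : ℝ) ^ 2 < Torus.freqNormSq κ →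
      mFourierCoeff (EuclideanSpace.complexify ∘ G) κ = 0 := fc_grad_eq_zero Φ hΦ ue
  have hfin : Torus.eGradNormSq (((ue : (Torus.energySpace (Fin 3))) : (Lp (EuclideanSpace ℝ (Fin 3)) 2 (volume : Measure (UnitAddTorus (Fin 3))))) : (UnitAddTorus (Fin 3)) → (EuclideanSpace ℝ (Fin 3))) ≠ ⊤ := by
    rw [eGradNormSq_congr_ae' hue]; exact eGradNormSq_modes_ne_top
  have hball' : ‖ue‖ ^ 2 ≤ 16 * (∫ x, ‖f x‖ ^ 2) / ν ^ 2 := by rw [norm_sq_of_ae hue]; exact hball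
  have h := hfl hfin hball'
  rw [nsGeneratorPairing_of_ae hue, pairing_of_ae hue, eGradNormSq_congr_ae' hue] at h
  -- (1) forcing term
  have h1 : ∫ x, ⟪f x, G x⟫_ℝ ≤ Real.sqrt (∫ x, ‖f x‖ ^ 2) * (Real.sqrt (∑ κ' ∈ Torus.freqBall N, ‖mFourierCoeff (EuclideanSpace.complexify ∘ G) κ'‖ ^ 2)) :=
    integral_inner_le_coeffNorm (hf.memLp 2) hG.continuous hband
  -- (2) Laplacian term
  have h2 := laplacian_one_le hG hband k₀ z₀
  have h2' := mul_le_mul_of_nonneg_left ((le_abs_self _).trans h2) hν.le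
  -- (3) no self-interaction
  have h3 := inertial_mode_zero hG k₀ z₀ hdz
  -- (4) the energy input
  have h4 : ∫ x, ⟪(∑ mm, Torus.realTrigPoly {![k₀] mm} (fun _ => ![z₀] mm)) x, f x⟫_ℝ =
      (⟪z₀, mFourierCoeff (EuclideanSpace.complexify ∘ f) k₀⟫_ℂ).re := by
    rw [integral_inner_modes_left hf.integrable]
    simp only [Fin.sum_univ_one, Matrix.cons_val_fin_one]
  have hPD : 0 ≤ (∫ x, ⟪(∑ mm, Torus.realTrigPoly {![k₀] mm} (fun _ => ![z₀] mm)) x, f x⟫_ℝ) -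
      ν * (Torus.eGradNormSq ((∑ mm, Torus.realTrigPoly {![k₀] mm} (fun _ => ![z₀] mm)))).toReal := by
    rw [h4]; linarith
  have hθterm : 2 * θ * ((∫ x, ⟪(∑ mm, Torus.realTrigPoly {![k₀] mm} (fun _ => ![z₀] mm)) x, f x⟫_ℝ) -
      ν * (Torus.eGradNormSq ((∑ mm, Torus.realTrigPoly {![k₀] mm} (fun _ => ![z₀] mm)))).toReal) ≤ 0 :=
    mul_nonpos_of_nonpos_of_nonneg (by linarith) hPD
  rw [h3] at h
  linarith

set_option maxHeartbeats 1000000 in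
/-- **FLOOR at the injected beat state.** If the floor holds at `Re(e_{k₀} z₀) + Re(e_p zA) + Re(e_{p+q} zB)`
with the waves outside the band and the energy input of the mode dominating the dissipation and the wave
pairings, then `ε₀ ≤ ν‖∇u‖² + ‖f‖₂ 𝔊 + ν ‖z₀‖ 4π²|k₀|² 𝔊 − gain`, where `−gain` bounds the beat. -/
theorem floor_at_injected_beat {f : (UnitAddTorus (Fin 3)) → (EuclideanSpace ℝ (Fin 3))} (hf : Torus.IsSmooth f) {ν : ℝ} (hν : 0 < ν)
    (Φ : Torus.CylindricalTest (Fin 3)) {N : ℕ} (hΦ : ∀ i, Torus.fourierTruncate N (Φ.g i) = Φ.g i)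
    {θ ε₀ : ℝ} (hθ : θ ≤ 0) {k₀ p q : Fin 3 → ℤ} {z₀ zA zB : (EuclideanSpace ℂ (Fin 3))}
    (hdz : ((fun j => ((k₀) j : ℂ)) ⬝ᵥ (WithLp.ofLp (z₀))) = 0)
    (hA : ((fun j => ((p) j : ℂ)) ⬝ᵥ (WithLp.ofLp (zA))) = 0)
    (hB : ((fun j => (((p + q)) j : ℂ)) ⬝ᵥ (WithLp.ofLp (zB))) = 0)
    (ue : (Torus.energySpace (Fin 3)))
    (hue : (((ue : (Torus.energySpace (Fin 3))) : (Lp (EuclideanSpace ℝ (Fin 3)) 2 (volume : Measure (UnitAddTorus (Fin 3))))) : (UnitAddTorus (Fin 3)) → (EuclideanSpace ℝ (Fin 3))) =ᵐ[volume] (∑ mm, Torus.realTrigPoly {![k₀] mm} (fun _ => ![z₀] mm)))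
    (uw : (Torus.energySpace (Fin 3)))
    (huw : (((uw : (Torus.energySpace (Fin 3))) : (Lp (EuclideanSpace ℝ (Fin 3)) 2 (volume : Measure (UnitAddTorus (Fin 3))))) : (UnitAddTorus (Fin 3)) → (EuclideanSpace ℝ (Fin 3))) =ᵐ[volume] (∑ mm, Torus.realTrigPoly {![k₀, p, p + q] mm} (fun _ => ![z₀, zA, zB] mm)))
    (hNp : (N : ℝ) ^ 2 < Torus.freqNormSq p) (hNpq : (N : ℝ) ^ 2 < Torus.freqNormSq (p + q))
    (hN1 : (N : ℝ) ^ 2 < Torus.freqNormSq (p + k₀)) (hN2 : (N : ℝ) ^ 2 < Torus.freqNormSq (p - k₀))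
    (hN3 : (N : ℝ) ^ 2 < Torus.freqNormSq (p + q + k₀)) (hN4 : (N : ℝ) ^ 2 < Torus.freqNormSq (p + q - k₀))
    (hN5 : (N : ℝ) ^ 2 < Torus.freqNormSq (p + (p + q)))
    (hAq : ⟪(mFourierCoeff (EuclideanSpace.complexify ∘ (Φ.grad ue)) (-q)), zA⟫_ℂ = 0)
    {gain : ℝ}
    (hbeat : Real.pi * (conj (((fun j => ((q) j : ℂ)) ⬝ᵥ (WithLp.ofLp (zA)))) * ⟪(mFourierCoeff (EuclideanSpace.complexify ∘ (Φ.grad ue)) q), zB⟫_ℂ).im ≤ -gain)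
    (hball : ∫ x, ‖(∑ mm, Torus.realTrigPoly {![k₀, p, p + q] mm} (fun _ => ![z₀, zA, zB] mm)) x‖ ^ 2 ≤ 16 * (∫ x, ‖f x‖ ^ 2) / ν ^ 2)
    (hD : ν * (Torus.eGradNormSq ((∑ mm, Torus.realTrigPoly {![k₀, p, p + q] mm} (fun _ => ![z₀, zA, zB] mm)))).toReal ≤
      (⟪z₀, mFourierCoeff (EuclideanSpace.complexify ∘ f) k₀⟫_ℂ).re - ‖zA‖ * Real.sqrt (∫ x, ‖f x‖ ^ 2) - ‖zB‖ * Real.sqrt (∫ x, ‖f x‖ ^ 2))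
    (hfl : FloorIneq ν f Φ θ ε₀ uw) :
    ε₀ ≤ ν * (Torus.eGradNormSq ((∑ mm, Torus.realTrigPoly {![k₀, p, p + q] mm} (fun _ => ![z₀, zA, zB] mm)))).toReal +
      Real.sqrt (∫ x, ‖f x‖ ^ 2) * (Real.sqrt (∑ κ' ∈ Torus.freqBall N, ‖mFourierCoeff (EuclideanSpace.complexify ∘ (Φ.grad ue)) κ'‖ ^ 2)) +
      ν * (‖z₀‖ * (4 * Real.pi ^ 2 * Torus.freqNormSq k₀) * (Real.sqrt (∑ κ' ∈ Torus.freqBall N, ‖mFourierCoeff (EuclideanSpace.complexify ∘ (Φ.grad ue)) κ'‖ ^ 2))) - gain := by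
  set G := Φ.grad ue with hGdef
  have hG : Torus.IsSmooth G := isSmooth_grad Φ ue
  have hband : ∀ κ, (N : ℝ) ^ 2 < Torus.freqNormSq κ →
      mFourierCoeff (EuclideanSpace.complexify ∘ G) κ = 0 := fc_grad_eq_zero Φ hΦ ue
  have hband' : ∀ κ, (N : ℝ) ^ 2 < Torus.freqNormSq κ → (mFourierCoeff (EuclideanSpace.complexify ∘ G) κ) = 0 := hband
  -- the beat state has the same differential
  have hgrad : Φ.grad uw = G := by
    rw [hGdef]
    exact grad_eq_of_coords_eq Φ (coords_waves_invisible Φ hΦ hNp hNpq huw hue)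
  have hfin : Torus.eGradNormSq (((uw : (Torus.energySpace (Fin 3))) : (Lp (EuclideanSpace ℝ (Fin 3)) 2 (volume : Measure (UnitAddTorus (Fin 3))))) : (UnitAddTorus (Fin 3)) → (EuclideanSpace ℝ (Fin 3))) ≠ ⊤ := by
    rw [eGradNormSq_congr_ae' huw]; exact eGradNormSq_modes_ne_top
  have hball' : ‖uw‖ ^ 2 ≤ 16 * (∫ x, ‖f x‖ ^ 2) / ν ^ 2 := by rw [norm_sq_of_ae huw]; exact hball
  have h := hfl hfin hball'
  rw [hgrad, nsGeneratorPairing_of_ae huw, pairing_of_ae huw, eGradNormSq_congr_ae' huw] at h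
  -- (1) forcing term
  have h1 : ∫ x, ⟪f x, G x⟫_ℝ ≤ Real.sqrt (∫ x, ‖f x‖ ^ 2) * (Real.sqrt (∑ κ' ∈ Torus.freqBall N, ‖mFourierCoeff (EuclideanSpace.complexify ∘ G) κ'‖ ^ 2)) :=
    integral_inner_le_coeffNorm (hf.memLp 2) hG.continuous hband
  -- (2) Laplacian term: the waves do not contribute
  have h2 := laplacian_three_le hG hband k₀ z₀ zA zB (hband' p hNp) (hband' (p + q) hNpq)
  have h2' := mul_le_mul_of_nonneg_left ((le_abs_self _).trans h2) hν.le
  -- (3) the beat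
  have h3 : ∫ x, ⟪Torus.fderiv G x ((∑ mm, Torus.realTrigPoly {![k₀, p, p + q] mm} (fun _ => ![z₀, zA, zB] mm)) x),
      (∑ mm, Torus.realTrigPoly {![k₀, p, p + q] mm} (fun _ => ![z₀, zA, zB] mm)) x⟫_ℝ ≤ -gain := by
    rw [inertial_beat_gen hG k₀ p q z₀ zA zB hdz hA hB
      (hband' _ (by rwa [add_comm])) (hband' _ hN2) (hband' _ hN1)
      (hband' _ (by rwa [← neg_sub, Torus.freqNormSq_neg])) (hband' _ (by rwa [add_comm]))
      (hband' _ hN4) (hband' _ hN3) (hband' _ (by rwa [← neg_sub, Torus.freqNormSq_neg]))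
      (hband' _ hN5) (hband' _ (by rwa [add_comm])) hAq]
    exact hbeat
  -- (4) the energy input exceeds the dissipation: the weight term is signed away
  have h4 : ∫ x, ⟪(∑ mm, Torus.realTrigPoly {![k₀, p, p + q] mm} (fun _ => ![z₀, zA, zB] mm)) x, f x⟫_ℝ =
      (⟪z₀, mFourierCoeff (EuclideanSpace.complexify ∘ f) k₀⟫_ℂ).re +
        (⟪zA, mFourierCoeff (EuclideanSpace.complexify ∘ f) p⟫_ℂ).re +
        (⟪zB, mFourierCoeff (EuclideanSpace.complexify ∘ f) (p + q)⟫_ℂ).re := by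
    rw [integral_inner_modes_left hf.integrable]
    simp only [Fin.sum_univ_three, Matrix.cons_val_zero, Matrix.cons_val_one, Matrix.cons_val_two,
      Matrix.head_cons, Matrix.tail_cons, Fin.isValue]
  have hwA : |(⟪zA, mFourierCoeff (EuclideanSpace.complexify ∘ f) p⟫_ℂ).re| ≤ ‖zA‖ * Real.sqrt (∫ x, ‖f x‖ ^ 2) :=
    (abs_re_inner_le_norm_mul _ _).trans (mul_le_mul_of_nonneg_left (norm_fc_le_sqrt_integral (hf.memLp 2) _) (norm_nonneg _))
  have hwB : |(⟪zB, mFourierCoeff (EuclideanSpace.complexify ∘ f) (p + q)⟫_ℂ).re| ≤ ‖zB‖ * Real.sqrt (∫ x, ‖f x‖ ^ 2) :=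
    (abs_re_inner_le_norm_mul _ _).trans (mul_le_mul_of_nonneg_left (norm_fc_le_sqrt_integral (hf.memLp 2) _) (norm_nonneg _))
  have hwA' := neg_abs_le (⟪zA, mFourierCoeff (EuclideanSpace.complexify ∘ f) p⟫_ℂ).re
  have hwB' := neg_abs_le (⟪zB, mFourierCoeff (EuclideanSpace.complexify ∘ f) (p + q)⟫_ℂ).re
  have hPD : 0 ≤ (∫ x, ⟪(∑ mm, Torus.realTrigPoly {![k₀, p, p + q] mm} (fun _ => ![z₀, zA, zB] mm)) x, f x⟫_ℝ) -
      ν * (Torus.eGradNormSq ((∑ mm, Torus.realTrigPoly {![k₀, p, p + q] mm} (fun _ => ![z₀, zA, zB] mm)))).toReal := by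
    rw [h4]; linarith
  have hθterm : 2 * θ * ((∫ x, ⟪(∑ mm, Torus.realTrigPoly {![k₀, p, p + q] mm} (fun _ => ![z₀, zA, zB] mm)) x, f x⟫_ℝ) -
      ν * (Torus.eGradNormSq ((∑ mm, Torus.realTrigPoly {![k₀, p, p + q] mm} (fun _ => ![z₀, zA, zB] mm)))).toReal) ≤ 0 :=
    mul_nonpos_of_nonpos_of_nonneg (by linarith) hPD
  linarith

/-! ### §F.7 Arithmetic: the gain of the beat and the viscosity threshold -/

/-- **The gain of the injected beat** dominates the truncated norm linearly:
`(F + 2) 𝔊 ≤ π α² √|q|² |ζ|` once `π α² = (F + 2) Λ`, `Λ² = 2 #ball`, `𝔊² ≤ #ball ‖ĝ‖²`, `‖ĝ‖² ≤ 2|ζ|²`. -/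
theorem gain_gen {F Λ α 𝔊 card gn ζn fq : ℝ} (hF : 0 ≤ F + 2) (h𝔊 : 0 ≤ 𝔊) (hΛ : 0 ≤ Λ)
    (hΛsq : Λ ^ 2 = 2 * card) (hα : Real.pi * α ^ 2 = (F + 2) * Λ) (hg : 𝔊 ^ 2 ≤ card * gn ^ 2)
    (hζ : gn ^ 2 ≤ 2 * ζn ^ 2) (hζn : 0 ≤ ζn) (hfq : 1 ≤ fq) :
    (F + 2) * 𝔊 ≤ Real.pi * α * α * Real.sqrt fq * ζn := by
  have h1 : 𝔊 ^ 2 ≤ (Λ * ζn) ^ 2 := by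
    rw [mul_pow, hΛsq]; nlinarith
  have h2 : 𝔊 ≤ Λ * ζn := (pow_le_pow_iff_left₀ h𝔊 (mul_nonneg hΛ hζn) two_ne_zero).1 h1
  have h3 : 1 ≤ Real.sqrt fq := Real.one_le_sqrt.2 hfq
  have h4 : 0 ≤ Real.pi * α ^ 2 * ζn := by positivity
  calc (F + 2) * 𝔊 ≤ (F + 2) * (Λ * ζn) := mul_le_mul_of_nonneg_left h2 hF
    _ = Real.pi * α ^ 2 * ζn * 1 := by rw [← mul_assoc, ← hα]; ring
    _ ≤ Real.pi * α ^ 2 * ζn * Real.sqrt fq := mul_le_mul_of_nonneg_left h3 h4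
    _ = Real.pi * α * α * Real.sqrt fq * ζn := by ring

/-- One upper-bound demand on the viscosity. -/
theorem demand_of_le_div {ν a b : ℝ} (hν : 0 < ν) (ha : 0 ≤ a) (_hb : 0 < b) (h : ν ≤ b / (a + 1)) : ν * a ≤ b := by
  have ha1 : 0 < a + 1 := by linarith
  calc ν * a ≤ ν * (a + 1) := by nlinarith
    _ ≤ b / (a + 1) * (a + 1) := mul_le_mul_of_nonneg_right h ha1.le
    _ = b := div_mul_cancel₀ _ ha1.ne'

/-- **The viscosity threshold**: four upper-bound demands `ν · aᵢ ≤ bᵢ` hold for all `ν` below an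
explicit positive `ν₁`. -/
theorem exists_threshold {a₁ a₂ a₃ a₄ b₁ b₂ b₃ b₄ : ℝ} (ha₁ : 0 ≤ a₁) (ha₂ : 0 ≤ a₂) (ha₃ : 0 ≤ a₃) (ha₄ : 0 ≤ a₄)
    (hb₁ : 0 < b₁) (hb₂ : 0 < b₂) (hb₃ : 0 < b₃) (hb₄ : 0 < b₄) :
    ∃ ν₁ : ℝ, 0 < ν₁ ∧ ∀ ν : ℝ, 0 < ν → ν ≤ ν₁ →
      ν * a₁ ≤ b₁ ∧ ν * a₂ ≤ b₂ ∧ ν * a₃ ≤ b₃ ∧ ν * a₄ ≤ b₄ := by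
  refine ⟨min (min (b₁ / (a₁ + 1)) (b₂ / (a₂ + 1))) (min (b₃ / (a₃ + 1)) (b₄ / (a₄ + 1))), ?_, ?_⟩
  · have h1 : 0 < b₁ / (a₁ + 1) := div_pos hb₁ (by linarith)
    have h2 : 0 < b₂ / (a₂ + 1) := div_pos hb₂ (by linarith)
    have h3 : 0 < b₃ / (a₃ + 1) := div_pos hb₃ (by linarith)
    have h4 : 0 < b₄ / (a₄ + 1) := div_pos hb₄ (by linarith)
    exact lt_min (lt_min h1 h2) (lt_min h3 h4)
  · intro ν hν hle
    refine ⟨demand_of_le_div hν ha₁ hb₁ ?_, demand_of_le_div hν ha₂ hb₂ ?_,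
      demand_of_le_div hν ha₃ hb₃ ?_, demand_of_le_div hν ha₄ hb₄ ?_⟩
    · exact hle.trans ((min_le_left _ _).trans (min_le_left _ _))
    · exact hle.trans ((min_le_left _ _).trans (min_le_right _ _))
    · exact hle.trans ((min_le_right _ _).trans (min_le_left _ _))
    · exact hle.trans ((min_le_right _ _).trans (min_le_right _ _))

/-! ### §F.8 The strengthening of bounded resolution and its refutation -/

/-- NATURAL STRENGTHENING of the crux — floor certificates of BOUNDED RESOLUTION: some force, `ε₀, ν₀`
and a `ν`-INDEPENDENT degree `N` such that for every `ν ∈ (0, ν₀)` some cylindrical multiplier whose test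
fields are trigonometric polynomials of degree `≤ N` (profile `φ`, number of fields and weight `θ₁ ≤ 0`
free to depend on `ν`) certifies the floor. It implies `FloorCertificate` (forget the band limitation;
one line, kept out of this negative-side file) and is FALSE for every force
(`not_floorCertificateFixedResolution`). -/
def FloorCertificateFixedResolution : Prop :=
  ∃ f : (UnitAddTorus (Fin 3) → EuclideanSpace ℝ (Fin 3)), Torus.IsSmooth f ∧ Torus.IsDivFree f ∧ Torus.HasZeroMean f ∧
    ∃ (ε₀ ν₀ : ℝ) (N : ℕ), 0 < ε₀ ∧ 0 < ν₀ ∧ ∀ ν : ℝ, 0 < ν → ν < ν₀ →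
      ∃ (Φ₁ : Torus.CylindricalTest (Fin 3)) (θ₁ : ℝ), (∀ i, Torus.fourierTruncate N (Φ₁.g i) = Φ₁.g i) ∧ θ₁ ≤ 0 ∧
        ∀ u : (Torus.energySpace (Fin 3)), FloorIneq ν f Φ₁ θ₁ ε₀ u


/-- Bounded resolution is a strengthening of the crux (forget the band limitation). -/
theorem floorCertificate_of_fixedResolution (h : FloorCertificateFixedResolution) : FloorCertificate := by
  obtain ⟨f, hfs, hdiv, hmean, ε₀, ν₀, N, hε₀, hν₀, hcert⟩ := h
  refine ⟨f, hfs, hdiv, hmean, ε₀, ν₀, hε₀, hν₀, fun ν hν hνν₀ => ?_⟩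
  obtain ⟨Φ₁, θ₁, -, hθ₁, hall⟩ := hcert ν hν hνν₀
  exact ⟨Φ₁, θ₁, hθ₁, hall⟩

set_option maxHeartbeats 1600000 in
/-- **The floor fails at every fixed resolution, for every force** (quantitative core). For every smooth
solenoidal mean-zero `f`, every `ε₀ > 0` and every degree `N` there is `ν₁ > 0` such that for EVERY
`0 < ν ≤ ν₁`, EVERY cylindrical `Φ` with test fields of degree `≤ N` and EVERY weight `θ ≤ 0`, some
finite-enstrophy state of the Leray ball violates the FLOOR inequality (witness: the injected beat, see the
module docstring). -/
theorem floor_fails_at_fixed_resolution {f : (UnitAddTorus (Fin 3) → EuclideanSpace ℝ (Fin 3))} (hfs : Torus.IsSmooth f)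
    (hdiv : Torus.IsDivFree f) (hmean : Torus.HasZeroMean f) {ε₀ : ℝ} (hε₀ : 0 < ε₀) (N : ℕ) :
    ∃ ν₁ : ℝ, 0 < ν₁ ∧ ∀ ν : ℝ, 0 < ν → ν ≤ ν₁ →
      ∀ (Φ : Torus.CylindricalTest (Fin 3)) (θ : ℝ), (∀ i, Torus.fourierTruncate N (Φ.g i) = Φ.g i) → θ ≤ 0 →
        ∃ u : (Torus.energySpace (Fin 3)), ¬ FloorIneq ν f Φ θ ε₀ u := by
  have hF2nn : 0 ≤ ∫ x, ‖f x‖ ^ 2 := integral_nonneg fun x => by positivity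
  by_cases hF0 : ∫ x, ‖f x‖ ^ 2 = 0
  · /- a vanishing force: the rest state violates every floor -/
    refine ⟨1, one_pos, fun ν hν _ Φ θ _ _ => ⟨0, fun hfl => ?_⟩⟩
    have h1 : Torus.eGradNormSq (((0 : (Torus.energySpace (Fin 3))) : (Lp (EuclideanSpace ℝ (Fin 3)) 2 (volume : Measure (UnitAddTorus (Fin 3))))) : (UnitAddTorus (Fin 3)) → (EuclideanSpace ℝ (Fin 3))) ≠ ⊤ := by
      rw [eGradNormSq_coe_zero]; exact ENNReal.zero_ne_top
    have h2 : ‖(0 : (Torus.energySpace (Fin 3)))‖ ^ 2 ≤ 16 * (∫ x, ‖f x‖ ^ 2) / ν ^ 2 := by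
      rw [norm_zero, hF0]; norm_num
    have h := hfl h1 h2
    have hzero := certificate_terms_at_zero (ae_zero_of_integral_sq_zero hfs hF0) ν θ (Φ.grad 0)
    linarith
  /- Step 1: the constants `F, k₀, ĉ, c, K, card, Λ, α, σ, S, L, E` and the threshold `ν₁`. -/
  have hF2pos : 0 < ∫ x, ‖f x‖ ^ 2 := lt_of_le_of_ne hF2nn (Ne.symm hF0)
  obtain ⟨F, hFdef⟩ : ∃ F : ℝ, F = Real.sqrt (∫ x, ‖f x‖ ^ 2) := ⟨_, rfl⟩
  have hF : 0 < F := by rw [hFdef]; exact Real.sqrt_pos.2 hF2pos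
  have hFsq : F ^ 2 = ∫ x, ‖f x‖ ^ 2 := by rw [hFdef]; exact Real.sq_sqrt hF2nn
  obtain ⟨k₀, hk₀, hck⟩ := exists_fc_ne_zero_of_force hfs hmean hF2pos
  obtain ⟨ĉ, hĉdef⟩ : ∃ ĉ : (EuclideanSpace ℂ (Fin 3)), ĉ = mFourierCoeff (EuclideanSpace.complexify ∘ f) k₀ := ⟨_, rfl⟩
  rw [← hĉdef] at hck
  obtain ⟨c, hcdef⟩ : ∃ c : ℝ, c = ‖ĉ‖ := ⟨_, rfl⟩
  have hc : 0 < c := by rw [hcdef]; exact norm_pos_iff.2 hck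
  obtain ⟨K, hKdef⟩ : ∃ K : ℕ, K = ⌈Torus.freqNormSq k₀⌉₊ := ⟨_, rfl⟩
  have hk₀K : Torus.freqNormSq k₀ ≤ (K : ℝ) := by rw [hKdef]; exact Nat.le_ceil _
  have hfk1 : 1 ≤ Torus.freqNormSq k₀ := Torus.one_le_freqNormSq_of_ne_zero hk₀
  have hK1' : (1 : ℝ) ≤ K := hfk1.trans hk₀K
  have hK1 : 1 ≤ K := by exact_mod_cast hK1'
  obtain ⟨card, hcarddef⟩ : ∃ card : ℝ, card = ((Torus.freqBall (d := Fin 3) N).card : ℝ) := ⟨_, rfl⟩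
  have hcard1 : 1 ≤ card := by
    have : 1 ≤ (Torus.freqBall (d := Fin 3) N).card :=
      Finset.card_pos.2 ⟨0, Torus.zero_mem_freqBall N⟩
    rw [hcarddef]; exact_mod_cast this
  obtain ⟨Λ, hΛdef⟩ : ∃ Λ : ℝ, Λ = Real.sqrt (2 * card) := ⟨_, rfl⟩
  have hΛ : 0 < Λ := by rw [hΛdef]; exact Real.sqrt_pos.2 (by linarith)
  have hΛsq : Λ ^ 2 = 2 * card := by rw [hΛdef]; exact Real.sq_sqrt (by linarith)
  obtain ⟨α, hαdef⟩ : ∃ α : ℝ, α = Real.sqrt ((F + 2) * Λ / Real.pi) := ⟨_, rfl⟩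
  have hα : 0 < α := by rw [hαdef]; exact Real.sqrt_pos.2 (by positivity)
  have hαsq : Real.pi * α ^ 2 = (F + 2) * Λ := by
    rw [hαdef, Real.sq_sqrt (by positivity)]
    field_simp
  obtain ⟨σ, hσdef⟩ : ∃ σ : ℝ, σ = (2 * α * F + 2) / c ^ 2 := ⟨_, rfl⟩
  have hσ : 0 < σ := by rw [hσdef]; positivity
  have hσc : σ * c ^ 2 = 2 * α * F + 2 := by rw [hσdef]; field_simp
  obtain ⟨S, hSdef⟩ : ∃ S : ℝ, S = σ * c + 2 * α := ⟨_, rfl⟩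
  have hS : 0 < S := by rw [hSdef]; positivity
  have hσcS : σ * c ≤ S := by rw [hSdef]; linarith
  obtain ⟨L, hLdef⟩ : ∃ L : ℕ, L = N ^ 2 + 2 * N + 2 * K + 5 := ⟨_, rfl⟩
  have hLK : (K : ℝ) ≤ (L : ℝ) ^ 2 := by
    have hN0 : (0 : ℝ) ≤ N := Nat.cast_nonneg N
    have h1 : (K : ℝ) ≤ L := by rw [hLdef]; push_cast; nlinarith
    have h2 : (1 : ℝ) ≤ L := hK1'.trans h1
    nlinarith
  have hk₀L : Torus.freqNormSq k₀ ≤ (L : ℝ) ^ 2 := hk₀K.trans hLK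
  obtain ⟨E, hEdef⟩ : ∃ E : ℝ, E = 4 * Real.pi ^ 2 * (L : ℝ) ^ 2 * S ^ 2 := ⟨_, rfl⟩
  have hE : 0 ≤ E := by rw [hEdef]; positivity
  obtain ⟨ν₁, hν₁, hdem⟩ := exists_threshold (a₁ := E) (a₂ := E) (a₃ := σ * c * (4 * Real.pi ^ 2 * K)) (a₄ := S)
    (b₁ := ε₀ / 2) (b₂ := 1) (b₃ := 1) (b₄ := 4 * F) hE hE (by positivity) hS.le (by positivity) one_pos one_pos (by positivity)
  refine ⟨ν₁, hν₁, fun ν hν hνle Φ θ hΦ hθ => ?_⟩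
  obtain ⟨hd1, hd2, hd3, hd4⟩ := hdem ν hν hνle
  /- Step 2: the injected polarisation `σ ĉ` and the single-mode state `ue`. -/
  have hdz : ((fun j => ((k₀) j : ℂ)) ⬝ᵥ (WithLp.ofLp (((σ : ℂ) • ĉ)))) = 0 := by
    rw [hĉdef]; exact dotc_injected hfs hdiv k₀ σ
  have hz₀ : ‖((σ : ℂ) • ĉ)‖ = σ * c := by rw [hcdef]; exact norm_injected hσ.le ĉ
  have hinj : (⟪((σ : ℂ) • ĉ), mFourierCoeff (EuclideanSpace.complexify ∘ f) k₀⟫_ℂ).re = σ * c ^ 2 := by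
    rw [hcdef, hĉdef]; exact injection_value k₀ σ
  obtain ⟨ue, hue⟩ := exists_state (![k₀] : Fin 1 → (Fin 3 → ℤ)) (![((σ : ℂ) • ĉ)] : Fin 1 → (EuclideanSpace ℂ (Fin 3)))
    (one_ne_zero_gen hk₀) (one_dotc_gen hdz)
  obtain ⟨G, hGdef⟩ : ∃ G : (UnitAddTorus (Fin 3)) → (EuclideanSpace ℝ (Fin 3)), G = Φ.grad ue := ⟨_, rfl⟩
  obtain ⟨𝔊, h𝔊def⟩ : ∃ 𝔊 : ℝ, 𝔊 = (Real.sqrt (∑ κ' ∈ Torus.freqBall N, ‖mFourierCoeff (EuclideanSpace.complexify ∘ G) κ'‖ ^ 2)) := ⟨_, rfl⟩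
  have h𝔊0 : 0 ≤ 𝔊 := by rw [h𝔊def]; exact coeffNorm_nonneg N G
  -- the Leray ball and the dissipation of the mode state
  have hSball : S ^ 2 ≤ 16 * (∫ x, ‖f x‖ ^ 2) / ν ^ 2 := by
    rw [← hFsq, le_div_iff₀ (by positivity)]
    have h4F : 0 ≤ 4 * F - ν * S := by linarith
    have hνS : 0 ≤ ν * S := by positivity
    nlinarith [mul_nonneg hνS h4F, mul_nonneg (mul_nonneg hνS hνS) (le_refl (0:ℝ))]
  have hsum1 : ∑ m, ‖(![((σ : ℂ) • ĉ)] : Fin 1 → (EuclideanSpace ℂ (Fin 3))) m‖ = σ * c := by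
    simp only [Fin.sum_univ_one, Matrix.cons_val_fin_one]; exact hz₀
  have hint1 : ∫ x, ‖(∑ mm, Torus.realTrigPoly {(![k₀] : Fin 1 → (Fin 3 → ℤ)) mm} (fun _ => (![((σ : ℂ) • ĉ)] : Fin 1 → (EuclideanSpace ℂ (Fin 3))) mm)) x‖ ^ 2 ≤ S ^ 2 := by
    refine integral_norm_sq_modes_le.trans ?_
    rw [hsum1]
    exact pow_le_pow_left₀ (by positivity) hσcS 2
  have hball1 : ∫ x, ‖(∑ mm, Torus.realTrigPoly {(![k₀] : Fin 1 → (Fin 3 → ℤ)) mm} (fun _ => (![((σ : ℂ) • ĉ)] : Fin 1 → (EuclideanSpace ℂ (Fin 3))) mm)) x‖ ^ 2 ≤ 16 * (∫ x, ‖f x‖ ^ 2) / ν ^ 2 := hint1.trans hSball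
  have hgrad1 : (Torus.eGradNormSq ((∑ mm, Torus.realTrigPoly {(![k₀] : Fin 1 → (Fin 3 → ℤ)) mm} (fun _ => (![((σ : ℂ) • ĉ)] : Fin 1 → (EuclideanSpace ℂ (Fin 3))) mm)))).toReal ≤ E := by
    have := toReal_eGradNormSq_modes_le (k := (![k₀] : Fin 1 → (Fin 3 → ℤ))) (z := (![((σ : ℂ) • ĉ)] : Fin 1 → (EuclideanSpace ℂ (Fin 3)))) (one_freq_le_gen hk₀L)
    rw [hEdef]
    exact this.trans (mul_le_mul_of_nonneg_left hint1 (by positivity))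
  have hD1 : ν * (Torus.eGradNormSq ((∑ mm, Torus.realTrigPoly {(![k₀] : Fin 1 → (Fin 3 → ℤ)) mm} (fun _ => (![((σ : ℂ) • ĉ)] : Fin 1 → (EuclideanSpace ℂ (Fin 3))) mm)))).toReal ≤ 1 := (mul_le_mul_of_nonneg_left hgrad1 hν.le).trans hd2
  have hD1' : ν * (Torus.eGradNormSq ((∑ mm, Torus.realTrigPoly {(![k₀] : Fin 1 → (Fin 3 → ℤ)) mm} (fun _ => (![((σ : ℂ) • ĉ)] : Fin 1 → (EuclideanSpace ℂ (Fin 3))) mm)))).toReal ≤ ε₀ / 2 := (mul_le_mul_of_nonneg_left hgrad1 hν.le).trans hd1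
  have hαF : 0 < α * F := mul_pos hα hF
  by_cases h𝔊z : 𝔊 = 0
  · /- Case A: the multiplier has no coefficients; the injected mode itself violates the floor. -/
    refine ⟨ue, fun hfl => ?_⟩
    have hmain := floor_at_mode hfs hν Φ hΦ hθ hdz ue hue hball1 (by rw [hinj, hσc]; linarith) hfl
    rw [← hGdef, ← h𝔊def, h𝔊z] at hmain
    simp only [mul_zero, add_zero] at hmain
    linarith
  · /- Case B: the injected beat. -/
    have h𝔊pos : 0 < 𝔊 := lt_of_le_of_ne h𝔊0 (Ne.symm h𝔊z)
    /- Step 3: the largest resolved coefficient `q`. -/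
    obtain ⟨q, hqmem, hqmax⟩ := Finset.exists_max_image (Torus.freqBall (d := Fin 3) N)
      (fun κ => ‖(mFourierCoeff (EuclideanSpace.complexify ∘ G) κ)‖) ⟨0, Torus.zero_mem_freqBall N⟩
    have hcardq : 𝔊 ^ 2 ≤ (Torus.freqBall (d := Fin 3) N).card * ‖(mFourierCoeff (EuclideanSpace.complexify ∘ G) q)‖ ^ 2 := by
      rw [h𝔊def]; exact coeffNorm_sq_le_card_mul hqmax
    obtain ⟨g, hgdef⟩ : ∃ g : (EuclideanSpace ℂ (Fin 3)), g = (mFourierCoeff (EuclideanSpace.complexify ∘ G) q) := ⟨_, rfl⟩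
    rw [← hgdef, ← hcarddef] at hcardq
    have hg0 : g ≠ 0 := by
      intro h
      rw [h, norm_zero] at hcardq
      have h2 : 0 < 𝔊 ^ 2 := by positivity
      have h3 : 𝔊 ^ 2 ≤ 0 := by simpa using hcardq
      linarith
    have hq0 : q ≠ 0 := by
      rintro rfl
      apply hg0
      rw [hgdef, hGdef]
      exact fc_grad_zero Φ _
    have hfqN : Torus.freqNormSq q ≤ (N : ℝ) ^ 2 := Torus.mem_freqBall.1 hqmem
    have hfq1 : 1 ≤ Torus.freqNormSq q := Torus.one_le_freqNormSq_of_ne_zero hq0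
    /- Step 4: the frame and the polarisation direction. -/
    have hgt : ((fun j => ((q) j : ℂ)) ⬝ᵥ (WithLp.ofLp (g))) = 0 := by rw [hgdef, hGdef]; exact dotc_fc_grad Φ _ q
    obtain ⟨r, B, hr0, hrq, hrq2, hB1, hrB, hqB, hgB⟩ := frame_selection hq0 g hgt
    obtain ⟨ζ, hζdef⟩ : ∃ ζ : ℂ, ζ = ⟪g, EuclideanSpace.complexify B⟫_ℂ := ⟨_, rfl⟩
    rw [← hζdef] at hgB
    have hζ0 : ζ ≠ 0 := by
      intro h
      rw [h, norm_zero] at hgB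
      have h2 : ‖g‖ ^ 2 ≤ 0 := by simpa using hgB
      have h3 : ‖g‖ ^ 2 = 0 := le_antisymm h2 (sq_nonneg _)
      exact hg0 (norm_eq_zero.1 (pow_eq_zero_iff two_ne_zero |>.1 h3))
    /- Step 5: the wave frequencies. -/
    obtain ⟨t, p, hpdef, hpq, hNp, hNpq, hN1, hN2, hN3, hN4, hN5, hLp, hLpq⟩ :=
      wave_frequencies_gen N hfqN hr0 hrq hrq2 hK1 hk₀K
    rw [← hLdef] at hLp hLpq
    have hp0 : p ≠ 0 := ne_zero_of_freqNormSq_pos (sq_nonneg _) hNp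
    have hpq0 : p + q ≠ 0 := ne_zero_of_freqNormSq_pos (sq_nonneg _) hNpq
    /- Step 6: the polarisations of the waves (FIXED amplitude `α`). -/
    have hzA : ‖((((α) / Real.sqrt (Torus.freqNormSq (q)) : ℝ) : ℂ) • EuclideanSpace.complexify (WithLp.toLp 2 (fun i => ((q) i : ℝ))))‖ = α := norm_polA hα.le hq0
    have hzB : ‖(((-Complex.I * conj ((ζ)) * ((‖(ζ)‖⁻¹ : ℝ) : ℂ)) * ((α) : ℂ)) • EuclideanSpace.complexify (B))‖ = α := norm_polB α hα.le hζ0 hB1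
    have hdA : ((fun j => ((p) j : ℂ)) ⬝ᵥ (WithLp.ofLp (((((α) / Real.sqrt (Torus.freqNormSq (q)) : ℝ) : ℂ) • EuclideanSpace.complexify (WithLp.toLp 2 (fun i => ((q) i : ℝ))))))) = 0 := by
      rw [dotc_polA, hpq]; simp
    have hdB : ((fun j => (((p + q)) j : ℂ)) ⬝ᵥ (WithLp.ofLp ((((-Complex.I * conj ((ζ)) * ((‖(ζ)‖⁻¹ : ℝ) : ℂ)) * ((α) : ℂ)) • EuclideanSpace.complexify (B))))) = 0 := by
      rw [dotc_polB]
      have hsum : (∑ j, ((p + q) j : ℝ) * B j) = 0 := by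
        have e : ∀ j, ((p + q) j : ℝ) * B j = (t : ℝ) * ((r j : ℝ) * B j) + (q j : ℝ) * B j := by
          intro j
          rw [hpdef]
          simp only [Pi.add_apply, Int.cast_add, Int.cast_mul, Int.cast_natCast]
          ring
        simp_rw [e, Finset.sum_add_distrib, ← Finset.mul_sum, hrB, hqB]
        ring
      rw [hsum]; simp
    obtain ⟨uw, huw⟩ := exists_state (![k₀, p, p + q] : Fin 3 → (Fin 3 → ℤ))
      (![((σ : ℂ) • ĉ), ((((α) / Real.sqrt (Torus.freqNormSq (q)) : ℝ) : ℂ) • EuclideanSpace.complexify (WithLp.toLp 2 (fun i => ((q) i : ℝ)))), (((-Complex.I * conj ((ζ)) * ((‖(ζ)‖⁻¹ : ℝ) : ℂ)) * ((α) : ℂ)) • EuclideanSpace.complexify (B))] : Fin 3 → (EuclideanSpace ℂ (Fin 3)))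
      (three_ne_zero_gen hk₀ hp0 hpq0) (three_dotc_gen hdz hdA hdB)
    -- transversality of the multiplier at `-q` makes the `(p + q, p)` interaction vanish
    have hAq : ⟪(mFourierCoeff (EuclideanSpace.complexify ∘ (Φ.grad ue)) (-q)), ((((α) / Real.sqrt (Torus.freqNormSq (q)) : ℝ) : ℂ) • EuclideanSpace.complexify (WithLp.toLp 2 (fun i => ((q) i : ℝ))))⟫_ℂ = 0 := by
      rw [inner_polA]
      have h := dotc_fc_grad Φ ue (-q)
      rw [dotc_neg_left, neg_eq_zero] at h
      rw [h, map_zero, mul_zero]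
    -- the value of the beat and the gain
    have hbeat0 : Real.pi * (conj (((fun j => ((q) j : ℂ)) ⬝ᵥ (WithLp.ofLp (((((α) / Real.sqrt (Torus.freqNormSq (q)) : ℝ) : ℂ) • EuclideanSpace.complexify (WithLp.toLp 2 (fun i => ((q) i : ℝ)))))))) *
        ⟪(mFourierCoeff (EuclideanSpace.complexify ∘ (Φ.grad ue)) q), (((-Complex.I * conj ((ζ)) * ((‖(ζ)‖⁻¹ : ℝ) : ℂ)) * ((α) : ℂ)) • EuclideanSpace.complexify (B))⟫_ℂ).im ≤
        -(Real.pi * α * α * Real.sqrt (Torus.freqNormSq q) * ‖ζ‖) := by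
      rw [← hGdef, ← hgdef, hζdef]
      exact (beat_value g hq0 α α B (hζdef ▸ hζ0)).le
    have hgain : (F + 2) * 𝔊 ≤ Real.pi * α * α * Real.sqrt (Torus.freqNormSq q) * ‖ζ‖ :=
      gain_gen (by linarith) h𝔊0 hΛ.le hΛsq hαsq hcardq hgB (norm_nonneg ζ) hfq1
    have hbeat : Real.pi * (conj (((fun j => ((q) j : ℂ)) ⬝ᵥ (WithLp.ofLp (((((α) / Real.sqrt (Torus.freqNormSq (q)) : ℝ) : ℂ) • EuclideanSpace.complexify (WithLp.toLp 2 (fun i => ((q) i : ℝ)))))))) *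
        ⟪(mFourierCoeff (EuclideanSpace.complexify ∘ (Φ.grad ue)) q), (((-Complex.I * conj ((ζ)) * ((‖(ζ)‖⁻¹ : ℝ) : ℂ)) * ((α) : ℂ)) • EuclideanSpace.complexify (B))⟫_ℂ).im ≤ -((F + 2) * 𝔊) :=
      hbeat0.trans (by linarith)
    /- Step 7: energies of the beat state and the FLOOR there. -/
    have hsum3 : ∑ m, ‖(![((σ : ℂ) • ĉ), ((((α) / Real.sqrt (Torus.freqNormSq (q)) : ℝ) : ℂ) • EuclideanSpace.complexify (WithLp.toLp 2 (fun i => ((q) i : ℝ)))), (((-Complex.I * conj ((ζ)) * ((‖(ζ)‖⁻¹ : ℝ) : ℂ)) * ((α) : ℂ)) • EuclideanSpace.complexify (B))] : Fin 3 → (EuclideanSpace ℂ (Fin 3))) m‖ = S := by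
      simp only [Fin.sum_univ_three, Matrix.cons_val_zero, Matrix.cons_val_one, Matrix.cons_val_two,
        Matrix.head_cons, Matrix.tail_cons, Fin.isValue]
      rw [hz₀, hzA, hzB, hSdef]; ring
    have hint3 : ∫ x, ‖(∑ mm, Torus.realTrigPoly {(![k₀, p, p + q] : Fin 3 → (Fin 3 → ℤ)) mm} (fun _ => (![((σ : ℂ) • ĉ), ((((α) / Real.sqrt (Torus.freqNormSq (q)) : ℝ) : ℂ) • EuclideanSpace.complexify (WithLp.toLp 2 (fun i => ((q) i : ℝ)))), (((-Complex.I * conj ((ζ)) * ((‖(ζ)‖⁻¹ : ℝ) : ℂ)) * ((α) : ℂ)) • EuclideanSpace.complexify (B))] : Fin 3 → (EuclideanSpace ℂ (Fin 3))) mm)) x‖ ^ 2 ≤ S ^ 2 := by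
      refine integral_norm_sq_modes_le.trans ?_
      rw [hsum3]
    have hball3 : ∫ x, ‖(∑ mm, Torus.realTrigPoly {(![k₀, p, p + q] : Fin 3 → (Fin 3 → ℤ)) mm} (fun _ => (![((σ : ℂ) • ĉ), ((((α) / Real.sqrt (Torus.freqNormSq (q)) : ℝ) : ℂ) • EuclideanSpace.complexify (WithLp.toLp 2 (fun i => ((q) i : ℝ)))), (((-Complex.I * conj ((ζ)) * ((‖(ζ)‖⁻¹ : ℝ) : ℂ)) * ((α) : ℂ)) • EuclideanSpace.complexify (B))] : Fin 3 → (EuclideanSpace ℂ (Fin 3))) mm)) x‖ ^ 2 ≤ 16 * (∫ x, ‖f x‖ ^ 2) / ν ^ 2 := hint3.trans hSball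
    have hgrad3 : (Torus.eGradNormSq ((∑ mm, Torus.realTrigPoly {(![k₀, p, p + q] : Fin 3 → (Fin 3 → ℤ)) mm} (fun _ => (![((σ : ℂ) • ĉ), ((((α) / Real.sqrt (Torus.freqNormSq (q)) : ℝ) : ℂ) • EuclideanSpace.complexify (WithLp.toLp 2 (fun i => ((q) i : ℝ)))), (((-Complex.I * conj ((ζ)) * ((‖(ζ)‖⁻¹ : ℝ) : ℂ)) * ((α) : ℂ)) • EuclideanSpace.complexify (B))] : Fin 3 → (EuclideanSpace ℂ (Fin 3))) mm)))).toReal ≤ E := by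
      have := toReal_eGradNormSq_modes_le (k := (![k₀, p, p + q] : Fin 3 → (Fin 3 → ℤ)))
        (z := (![((σ : ℂ) • ĉ), ((((α) / Real.sqrt (Torus.freqNormSq (q)) : ℝ) : ℂ) • EuclideanSpace.complexify (WithLp.toLp 2 (fun i => ((q) i : ℝ)))), (((-Complex.I * conj ((ζ)) * ((‖(ζ)‖⁻¹ : ℝ) : ℂ)) * ((α) : ℂ)) • EuclideanSpace.complexify (B))] : Fin 3 → (EuclideanSpace ℂ (Fin 3)))) (three_freq_le_gen hk₀L hLp hLpq)
      rw [hEdef]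
      exact this.trans (mul_le_mul_of_nonneg_left hint3 (by positivity))
    have hD3 : ν * (Torus.eGradNormSq ((∑ mm, Torus.realTrigPoly {(![k₀, p, p + q] : Fin 3 → (Fin 3 → ℤ)) mm} (fun _ => (![((σ : ℂ) • ĉ), ((((α) / Real.sqrt (Torus.freqNormSq (q)) : ℝ) : ℂ) • EuclideanSpace.complexify (WithLp.toLp 2 (fun i => ((q) i : ℝ)))), (((-Complex.I * conj ((ζ)) * ((‖(ζ)‖⁻¹ : ℝ) : ℂ)) * ((α) : ℂ)) • EuclideanSpace.complexify (B))] : Fin 3 → (EuclideanSpace ℂ (Fin 3))) mm)))).toReal ≤ 1 := (mul_le_mul_of_nonneg_left hgrad3 hν.le).trans hd2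
    have hD3' : ν * (Torus.eGradNormSq ((∑ mm, Torus.realTrigPoly {(![k₀, p, p + q] : Fin 3 → (Fin 3 → ℤ)) mm} (fun _ => (![((σ : ℂ) • ĉ), ((((α) / Real.sqrt (Torus.freqNormSq (q)) : ℝ) : ℂ) • EuclideanSpace.complexify (WithLp.toLp 2 (fun i => ((q) i : ℝ)))), (((-Complex.I * conj ((ζ)) * ((‖(ζ)‖⁻¹ : ℝ) : ℂ)) * ((α) : ℂ)) • EuclideanSpace.complexify (B))] : Fin 3 → (EuclideanSpace ℂ (Fin 3))) mm)))).toReal ≤ ε₀ / 2 := (mul_le_mul_of_nonneg_left hgrad3 hν.le).trans hd1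
    refine ⟨uw, fun hfl => ?_⟩
    have hmain := floor_at_injected_beat hfs hν Φ hΦ hθ hdz hdA hdB ue hue uw huw hNp hNpq hN1 hN2 hN3 hN4 hN5
      hAq hbeat hball3 (by rw [hinj, hzA, hzB, ← hFdef, hσc]; linarith) hfl
    rw [← hGdef, ← h𝔊def, ← hFdef, hz₀] at hmain
    -- the Laplacian term is at most `𝔊`
    have hlap1 : ν * (σ * c * (4 * Real.pi ^ 2 * Torus.freqNormSq k₀)) ≤ 1 := by
      have hmono : σ * c * (4 * Real.pi ^ 2 * Torus.freqNormSq k₀) ≤ σ * c * (4 * Real.pi ^ 2 * K) :=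
        mul_le_mul_of_nonneg_left (mul_le_mul_of_nonneg_left hk₀K (by positivity)) (by positivity)
      exact (mul_le_mul_of_nonneg_left hmono hν.le).trans hd3
    have hlap : ν * (σ * c * (4 * Real.pi ^ 2 * Torus.freqNormSq k₀) * 𝔊) ≤ 𝔊 := by
      calc ν * (σ * c * (4 * Real.pi ^ 2 * Torus.freqNormSq k₀) * 𝔊)
          = (ν * (σ * c * (4 * Real.pi ^ 2 * Torus.freqNormSq k₀))) * 𝔊 := by ring
        _ ≤ 1 * 𝔊 := mul_le_mul_of_nonneg_right hlap1 h𝔊0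
        _ = 𝔊 := one_mul _
    linarith

/-- **No floor certificate of bounded resolution exists, for any force** (refutation of the natural
strengthening `FloorCertificateFixedResolution`; witness: the injected beat). MORAL: the resolution of the
multiplier of any witness of `FloorCertificate` must grow without bound as `ν → 0`; an unbounded weight
`θ₁(ν)` and a `ν`-dependent profile `φ_ν` cannot substitute for it. -/
theorem not_floorCertificateFixedResolution : ¬ FloorCertificateFixedResolution := by
  rintro ⟨f, hfs, hdiv, hmean, ε₀, ν₀, N, hε₀, hν₀, hcert⟩
  obtain ⟨ν₁, hν₁, hfail⟩ := floor_fails_at_fixed_resolution hfs hdiv hmean hε₀ N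
  have hν : 0 < min ν₁ (ν₀ / 2) := lt_min hν₁ (half_pos hν₀)
  obtain ⟨Φ, θ, hΦ, hθ, hall⟩ := hcert (min ν₁ (ν₀ / 2)) hν ((min_le_right _ _).trans_lt (half_lt_self hν₀))
  obtain ⟨u, hu⟩ := hfail (min ν₁ (ν₀ / 2)) hν (min_le_left _ _) Φ θ hΦ hθ
  exact hu (hall u)

/-- **What a witness of the crux must look like (resolution).** For the force of any floor family, every
degree `N` and every `ε₀ > 0`, below a threshold `ν₁(f, ε₀, N) > 0` EVERY valid certificate `(Φ₁, θ₁)`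
(`θ₁ ≤ 0`, floor at level `ε₀` on the whole finite-enstrophy Leray ball) uses a test field which is NOT a
trigonometric polynomial of degree `≤ N`. -/
theorem floor_witness_exceeds_resolution {f : (UnitAddTorus (Fin 3) → EuclideanSpace ℝ (Fin 3))} (hfs : Torus.IsSmooth f)
    (hdiv : Torus.IsDivFree f) (hmean : Torus.HasZeroMean f) {ε₀ : ℝ} (hε₀ : 0 < ε₀) (N : ℕ) :
    ∃ ν₁ : ℝ, 0 < ν₁ ∧ ∀ ν : ℝ, 0 < ν → ν ≤ ν₁ →
      ∀ (Φ : Torus.CylindricalTest (Fin 3)) (θ : ℝ), θ ≤ 0 →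
        (∀ u : (Torus.energySpace (Fin 3)), FloorIneq ν f Φ θ ε₀ u) →
          ∃ i, Torus.fourierTruncate N (Φ.g i) ≠ Φ.g i := by
  obtain ⟨ν₁, hν₁, hfail⟩ := floor_fails_at_fixed_resolution hfs hdiv hmean hε₀ N
  refine ⟨ν₁, hν₁, fun ν hν hle Φ θ hθ hall => ?_⟩
  by_contra hcon
  push Not at hcon
  obtain ⟨u, hu⟩ := hfail ν hν hle Φ θ hcon hθ
  exact hu (hall u)

/-! ## §F′ (cycle 2, NEW): no FROZEN multiplier certifies the floor, for any force, whatever the weight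

`FloorCertificateFixedMultiplier` (ONE cylindrical `Φ₁` — smooth test fields of any resolution, fixed profile —
chosen before `ν`; weight `θ₁(ν) ≤ 0` free) is FALSE for every force: `not_floorCertificateFixedMultiplier`,
by the INJECTED frozen-multiplier beat (injected mode of the force + two waves escaping along a lattice ray;
weighted Riemann–Lebesgue for the tails). Landing as `Negative/{FixedMultiplierTools,FixedMultiplier}.lean`. -/

/-! ### Norm bounds for the transversal product -/

/-- Cauchy–Schwarz for the transversal product: `|κ · z| ≤ |κ| ‖z‖`. -/
theorem norm_dotc_le (κ : Fin 3 → ℤ) (z : (EuclideanSpace ℂ (Fin 3))) :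
    ‖((fun j => ((κ) j : ℂ)) ⬝ᵥ (WithLp.ofLp (z)))‖ ≤ Real.sqrt (Torus.freqNormSq κ) * ‖z‖ := by
  have h1 : ‖((fun j => ((κ) j : ℂ)) ⬝ᵥ (WithLp.ofLp (z)))‖ = ‖⟪z, EuclideanSpace.complexify (WithLp.toLp 2 ((fun i => ((κ) i : ℝ))))⟫_ℂ‖ := by
    rw [inner_complexify_castR, Complex.norm_conj]
  have h2 : ‖(EuclideanSpace.complexify (WithLp.toLp 2 ((fun i => ((κ) i : ℝ)))) : EuclideanSpace ℂ (Fin 3))‖ = Real.sqrt (Torus.freqNormSq κ) := by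
    rw [EuclideanSpace.norm_complexify, ← Real.sqrt_sq (norm_nonneg _), norm_sq_toLp, ← freqNormSq_eq_castR_dot]
  rw [h1]
  calc ‖⟪z, EuclideanSpace.complexify (WithLp.toLp 2 ((fun i => ((κ) i : ℝ))))⟫_ℂ‖
      ≤ ‖z‖ * ‖(EuclideanSpace.complexify (WithLp.toLp 2 ((fun i => ((κ) i : ℝ)))) : EuclideanSpace ℂ (Fin 3))‖ := norm_inner_le_norm _ _
    _ = Real.sqrt (Torus.freqNormSq κ) * ‖z‖ := by rw [h2, mul_comm]

/-- `|κ| ≤ ∑ⱼ |κⱼ|` on the lattice. -/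
theorem sqrt_freqNormSq_le_sum_abs (κ : Fin 3 → ℤ) :
    Real.sqrt (Torus.freqNormSq κ) ≤ ∑ j, |((κ j : ℤ) : ℝ)| := by
  rw [Real.sqrt_le_left (Finset.sum_nonneg fun j _ => abs_nonneg _)]
  simp only [Torus.freqNormSq, Fin.sum_univ_three]
  nlinarith [abs_nonneg ((κ 0 : ℤ) : ℝ), abs_nonneg ((κ 1 : ℤ) : ℝ), abs_nonneg ((κ 2 : ℤ) : ℝ),
    sq_abs ((κ 0 : ℤ) : ℝ), sq_abs ((κ 1 : ℤ) : ℝ), sq_abs ((κ 2 : ℤ) : ℝ)]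

/-! ### Weighted Riemann–Lebesgue along a lattice ray -/

/-- The coefficients of a partial derivative: `‖𝓕(∂ⱼ g)(κ)‖ = 2π |κⱼ| ‖ĝ(κ)‖`. -/
theorem norm_fc_partialDeriv {g : (UnitAddTorus (Fin 3)) → (EuclideanSpace ℝ (Fin 3))} (hg : Torus.IsSmooth g) (j : Fin 3) (κ : Fin 3 → ℤ) :
    ‖mFourierCoeff (EuclideanSpace.complexify ∘ Torus.partialDeriv j g) κ‖ = 2 * Real.pi * |((κ j : ℤ) : ℝ)| * ‖mFourierCoeff (EuclideanSpace.complexify ∘ g) κ‖ := by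
  rw [Torus.mFourierCoeff_complexify_partialDeriv hg j κ, norm_smul]
  congr 1
  rw [norm_mul, norm_mul, norm_mul, Complex.norm_ofNat, Complex.norm_real, Real.norm_of_nonneg Real.pi_pos.le,
    Complex.norm_I, mul_one, Complex.norm_intCast]

/-- **Weighted Riemann–Lebesgue along a ray**: `|κ_t| ‖ĝ(κ_t)‖ → 0` along `κ_t = t s + c` (`s ≠ 0`) for a
smooth field `g` (the coefficients of each `∂ⱼ g` are absolutely summable). -/
theorem tendsto_weighted_fc_ray {g : (UnitAddTorus (Fin 3)) → (EuclideanSpace ℝ (Fin 3))} (hg : Torus.IsSmooth g) {s : Fin 3 → ℤ} (hs : s ≠ 0)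
    (c : Fin 3 → ℤ) :
    Tendsto (fun t : ℕ => Real.sqrt (Torus.freqNormSq ((fun i => (t : ℤ) * s i) + c)) *
      ‖mFourierCoeff (EuclideanSpace.complexify ∘ g) ((fun i => (t : ℤ) * s i) + c)‖) atTop (𝓝 0) := by
  -- each `|κⱼ| ‖ĝ(κ)‖` tends to zero along the ray
  have hj : ∀ j : Fin 3, Tendsto (fun t : ℕ => |((((fun i => (t : ℤ) * s i) + c) j : ℤ) : ℝ)| *
      ‖mFourierCoeff (EuclideanSpace.complexify ∘ g) ((fun i => (t : ℤ) * s i) + c)‖) atTop (𝓝 0) := by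
    intro j
    have h1 : Tendsto (fun t : ℕ => ‖mFourierCoeff (EuclideanSpace.complexify ∘ Torus.partialDeriv j g) ((fun i => (t : ℤ) * s i) + c)‖)
        atTop (𝓝 0) := tendsto_fc_ray (hg.partialDeriv j) hs c
    have h2 : ∀ t : ℕ, |((((fun i => (t : ℤ) * s i) + c) j : ℤ) : ℝ)| *
        ‖mFourierCoeff (EuclideanSpace.complexify ∘ g) ((fun i => (t : ℤ) * s i) + c)‖ =
        (2 * Real.pi)⁻¹ * ‖mFourierCoeff (EuclideanSpace.complexify ∘ Torus.partialDeriv j g) ((fun i => (t : ℤ) * s i) + c)‖ := by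
      intro t
      rw [norm_fc_partialDeriv hg j]
      field_simp
    simp_rw [h2]
    simpa using h1.const_mul ((2 * Real.pi)⁻¹)
  have hsum : Tendsto (fun t : ℕ => ∑ j, |((((fun i => (t : ℤ) * s i) + c) j : ℤ) : ℝ)| *
      ‖mFourierCoeff (EuclideanSpace.complexify ∘ g) ((fun i => (t : ℤ) * s i) + c)‖) atTop (𝓝 0) := by
    simpa using tendsto_finsetSum Finset.univ fun j _ => hj j
  refine squeeze_zero (fun t => by positivity) (fun t => ?_) hsum
  rw [← Finset.sum_mul]
  exact mul_le_mul_of_nonneg_right (sqrt_freqNormSq_le_sum_abs _) (norm_nonneg _)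

/-! ### A multiplier pushing against the force at a state has a nonzero mode -/

/-- If `(f, Φ'(u)) > 0` then `Φ'(u)` has a nonzero Fourier mode `q ≠ 0`. -/
theorem exists_fc_grad_ne_zero_at (Φ : Torus.CylindricalTest (Fin 3)) (u : (Torus.energySpace (Fin 3)))
    {f : (UnitAddTorus (Fin 3) → EuclideanSpace ℝ (Fin 3))} (hpos : 0 < ∫ x, ⟪f x, Φ.grad u x⟫_ℝ) :
    ∃ q : Fin 3 → ℤ, q ≠ 0 ∧ mFourierCoeff (EuclideanSpace.complexify ∘ Φ.grad u) q ≠ 0 := by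
  by_contra h
  push Not at h
  have hall : ∀ κ, mFourierCoeff (EuclideanSpace.complexify ∘ Φ.grad u) κ = 0 := by
    intro κ
    by_cases hκ : κ = 0
    · rw [hκ]; exact fc_grad_zero Φ u
    · exact h κ hκ
  have hzero : (EuclideanSpace.complexify ∘ Φ.grad u) = 0 :=
    Torus.eq_zero_of_forall_mFourierCoeff_eq_zero (isSmooth_grad Φ u).complexify_comp.continuous hall
  have hgrad : ∀ x, Φ.grad u x = 0 := by
    intro x
    have hx := congrFun hzero x
    simp only [Function.comp_apply, Pi.zero_apply] at hx
    have hn : ‖Φ.grad u x‖ = 0 := by rw [← EuclideanSpace.norm_complexify, hx, norm_zero]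
    exact norm_eq_zero.1 hn
  have : (∫ x, ⟪f x, Φ.grad u x⟫_ℝ) = 0 := by
    simp [hgrad]
  linarith

/-! ### The exact inertial term of an injected mode plus two waves against any smooth field -/

set_option maxHeartbeats 1000000 in
/-- **Injected mode + two waves, exact.** Inertial term of `Re(e_{k₀} zs) + Re(e_p zA) + Re(e_{p+q} zB)` against
a smooth `G` (transversality `zs ⊥ k₀`, `zA ⊥ p`, `zB ⊥ p + q`, `zB ⊥ p`, `zB ⊥ q`): the BEAT at `q` plus the nine
tail terms at `k₀ ± p`, `k₀ ± (p + q)`, `2p + q` (everything else vanishes identically). -/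
theorem inertial_three_exact {G : (UnitAddTorus (Fin 3)) → (EuclideanSpace ℝ (Fin 3))} (hG : Torus.IsSmooth G)
    (k₀ p q : Fin 3 → ℤ) (zs zA zB : (EuclideanSpace ℂ (Fin 3)))
    (hs : ((fun j => ((k₀) j : ℂ)) ⬝ᵥ (WithLp.ofLp (zs))) = 0)
    (hA : ((fun j => ((p) j : ℂ)) ⬝ᵥ (WithLp.ofLp (zA))) = 0)
    (hB : ((fun j => (((p + q)) j : ℂ)) ⬝ᵥ (WithLp.ofLp (zB))) = 0)
    (hpB : ((fun j => ((p) j : ℂ)) ⬝ᵥ (WithLp.ofLp (zB))) = 0)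
    (hqB : ((fun j => ((q) j : ℂ)) ⬝ᵥ (WithLp.ofLp (zB))) = 0) :
    ∫ x, ⟪Torus.fderiv G x ((∑ mm, Torus.realTrigPoly {![k₀, p, p + q] mm} (fun _ => ![zs, zA, zB] mm)) x),
        (∑ mm, Torus.realTrigPoly {![k₀, p, p + q] mm} (fun _ => ![zs, zA, zB] mm)) x⟫_ℝ =
      Real.pi * ((((fun j => (((k₀ + p)) j : ℂ)) ⬝ᵥ (WithLp.ofLp (zs)))) * ⟪(mFourierCoeff (EuclideanSpace.complexify ∘ G) (k₀ + p)), zA⟫_ℂ).im +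
            Real.pi * (conj (((fun j => (((p - k₀)) j : ℂ)) ⬝ᵥ (WithLp.ofLp (zs)))) * ⟪(mFourierCoeff (EuclideanSpace.complexify ∘ G) (p - k₀)), zA⟫_ℂ).im +
          (Real.pi * ((((fun j => (((k₀ + (p + q))) j : ℂ)) ⬝ᵥ (WithLp.ofLp (zs)))) * ⟪(mFourierCoeff (EuclideanSpace.complexify ∘ G) (k₀ + (p + q))), zB⟫_ℂ).im +
            Real.pi * (conj (((fun j => (((p + q - k₀)) j : ℂ)) ⬝ᵥ (WithLp.ofLp (zs)))) * ⟪(mFourierCoeff (EuclideanSpace.complexify ∘ G) (p + q - k₀)), zB⟫_ℂ).im) +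
        (Real.pi * ((((fun j => (((p + k₀)) j : ℂ)) ⬝ᵥ (WithLp.ofLp (zA)))) * ⟪(mFourierCoeff (EuclideanSpace.complexify ∘ G) (p + k₀)), zs⟫_ℂ).im +
            Real.pi * (conj (((fun j => (((k₀ - p)) j : ℂ)) ⬝ᵥ (WithLp.ofLp (zA)))) * ⟪(mFourierCoeff (EuclideanSpace.complexify ∘ G) (k₀ - p)), zs⟫_ℂ).im +
          (Real.pi * ((((fun j => (((p + (p + q))) j : ℂ)) ⬝ᵥ (WithLp.ofLp (zA)))) * ⟪(mFourierCoeff (EuclideanSpace.complexify ∘ G) (p + (p + q))), zB⟫_ℂ).im +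
            Real.pi * (conj (((fun j => ((q) j : ℂ)) ⬝ᵥ (WithLp.ofLp (zA)))) * ⟪(mFourierCoeff (EuclideanSpace.complexify ∘ G) q), zB⟫_ℂ).im)) +
      (Real.pi * ((((fun j => (((p + q + k₀)) j : ℂ)) ⬝ᵥ (WithLp.ofLp (zB)))) * ⟪(mFourierCoeff (EuclideanSpace.complexify ∘ G) (p + q + k₀)), zs⟫_ℂ).im +
        Real.pi * (conj (((fun j => (((k₀ - (p + q))) j : ℂ)) ⬝ᵥ (WithLp.ofLp (zB)))) * ⟪(mFourierCoeff (EuclideanSpace.complexify ∘ G) (k₀ - (p + q))), zs⟫_ℂ).im) := by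
  rw [inertial_modes hG]
  have e1 : p + q - p = q := add_sub_cancel_left p q
  have e2' : p - (p + q) = -q := by abel
  have d00 : ((fun j => (((k₀ + k₀)) j : ℂ)) ⬝ᵥ (WithLp.ofLp (zs))) = 0 := by rw [dotc_add_left, hs, add_zero]
  have d11 : ((fun j => (((p + p)) j : ℂ)) ⬝ᵥ (WithLp.ofLp (zA))) = 0 := by rw [dotc_add_left, hA, add_zero]
  have d22 : ((fun j => (((p + q + (p + q))) j : ℂ)) ⬝ᵥ (WithLp.ofLp (zB))) = 0 := by rw [dotc_add_left, hB, add_zero]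
  have d21 : ((fun j => (((p + q + p)) j : ℂ)) ⬝ᵥ (WithLp.ofLp (zB))) = 0 := by rw [dotc_add_left, hB, hpB, add_zero]
  have dnq : ((fun j => (((-q)) j : ℂ)) ⬝ᵥ (WithLp.ofLp (zB))) = 0 := by rw [dotc_neg_left, hqB, neg_zero]
  have hA2 : ((fun j => (((p + q - p)) j : ℂ)) ⬝ᵥ (WithLp.ofLp (zA))) = ((fun j => ((q) j : ℂ)) ⬝ᵥ (WithLp.ofLp (zA))) := by rw [e1]
  simp only [Fin.sum_univ_three, Matrix.cons_val_zero, Matrix.cons_val_one, Matrix.cons_val_two,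
    Matrix.head_cons, Matrix.tail_cons, sub_self, dotc_zero_left, d00, d11, d22, d21, hA2, e2', dnq,
    zero_mul, mul_zero, map_zero, Complex.zero_im, add_zero, zero_add]
  rw [e1]

/-! ### Tails of the injected three-mode state along an escaping ray -/

/-- **A tail term tends to zero.** Along states `u t` whose cylindrical coefficients converge, a pair-formula term
`π Im[a_t ⟪𝓕(Φ'(u t))(κ_t), w⟫]` with `|a_t| ≤ |κ_t| ‖z‖` and `κ_t` escaping along a lattice ray tends to zero
(weighted Riemann–Lebesgue for the finitely many smooth test fields). -/
theorem tendsto_tail (Φ : Torus.CylindricalTest (Fin 3)) (u : ℕ → (Torus.energySpace (Fin 3))) {cinf : Fin Φ.m → ℝ}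
    (hL3 : ∀ i, Tendsto (fun t => _root_.fderiv ℝ Φ.φ (Φ.coords (u t)) (EuclideanSpace.single i 1)) atTop (𝓝 (cinf i)))
    (κ : ℕ → (Fin 3 → ℤ)) {s c0 : Fin 3 → ℤ} (hs : s ≠ 0) (hκ : ∀ t, κ t = (fun i => (t : ℤ) * s i) + c0)
    (a : ℕ → ℂ) (z w : (EuclideanSpace ℂ (Fin 3))) (ha : ∀ t, ‖a t‖ ≤ Real.sqrt (Torus.freqNormSq (κ t)) * ‖z‖) :
    Tendsto (fun t => Real.pi * (a t * ⟪mFourierCoeff (EuclideanSpace.complexify ∘ Φ.grad (u t)) (κ t), w⟫_ℂ).im) atTop (𝓝 0) := by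
  have hb : Tendsto (fun t => ∑ i, |_root_.fderiv ℝ Φ.φ (Φ.coords (u t)) (EuclideanSpace.single i 1)| *
      (Real.sqrt (Torus.freqNormSq (κ t)) * ‖mFourierCoeff (EuclideanSpace.complexify ∘ Φ.g i) (κ t)‖)) atTop (𝓝 0) := by
    have : Tendsto (fun t => ∑ i, |_root_.fderiv ℝ Φ.φ (Φ.coords (u t)) (EuclideanSpace.single i 1)| *
        (Real.sqrt (Torus.freqNormSq (κ t)) * ‖mFourierCoeff (EuclideanSpace.complexify ∘ Φ.g i) (κ t)‖)) atTop
        (𝓝 (∑ i, |cinf i| * 0)) := by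
      refine tendsto_finsetSum _ fun i _ => (hL3 i).abs.mul ?_
      have h := tendsto_weighted_fc_ray (Φ.g_smooth i) hs c0
      refine h.congr fun t => ?_
      rw [hκ t]
    simpa using this
  refine squeeze_zero_norm (fun t => ?_) (by simpa using hb.const_mul (Real.pi * ‖z‖ * ‖w‖))
  have h1 := norm_fc_grad_le Φ (u t) (κ t)
  have h2 := ha t
  have hsq : 0 ≤ Real.sqrt (Torus.freqNormSq (κ t)) := Real.sqrt_nonneg _
  calc ‖Real.pi * (a t * ⟪mFourierCoeff (EuclideanSpace.complexify ∘ Φ.grad (u t)) (κ t), w⟫_ℂ).im‖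
      ≤ Real.pi * ‖a t‖ * ‖w‖ * ‖mFourierCoeff (EuclideanSpace.complexify ∘ Φ.grad (u t)) (κ t)‖ := norm_pi_mul_im_le _ _ _
    _ ≤ Real.pi * (Real.sqrt (Torus.freqNormSq (κ t)) * ‖z‖) * ‖w‖ *
          (∑ i, |_root_.fderiv ℝ Φ.φ (Φ.coords (u t)) (EuclideanSpace.single i 1)| * ‖mFourierCoeff (EuclideanSpace.complexify ∘ Φ.g i) (κ t)‖) := by
        have hx : 0 ≤ Real.pi * ‖a t‖ * ‖w‖ := by positivity
        have hy : Real.pi * ‖a t‖ * ‖w‖ ≤ Real.pi * (Real.sqrt (Torus.freqNormSq (κ t)) * ‖z‖) * ‖w‖ :=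
          mul_le_mul_of_nonneg_right (mul_le_mul_of_nonneg_left h2 Real.pi_pos.le) (norm_nonneg _)
        exact mul_le_mul hy h1 (norm_nonneg _) (by positivity)
    _ = Real.pi * ‖z‖ * ‖w‖ * ∑ i, |_root_.fderiv ℝ Φ.φ (Φ.coords (u t)) (EuclideanSpace.single i 1)| *
          (Real.sqrt (Torus.freqNormSq (κ t)) * ‖mFourierCoeff (EuclideanSpace.complexify ∘ Φ.g i) (κ t)‖) := by
        rw [Finset.mul_sum, Finset.mul_sum]
        exact Finset.sum_congr rfl fun i _ => by ring

/-! ### The strengthening of a frozen multiplier and its refutation -/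

/-- NATURAL STRENGTHENING of the crux — a FROZEN MULTIPLIER with a free weight: ONE cylindrical `Φ₁` (smooth
test fields of any resolution, fixed profile) chosen after `f` but before `ν`, and for every `ν ∈ (0, ν₀)` SOME
weight `θ₁ = θ₁(ν) ≤ 0`. Between `FloorCertificateUniform` (both frozen) and the crux; incomparable with
`FloorCertificateFixedResolution`. FALSE for every force (`not_floorCertificateFixedMultiplier`). -/
def FloorCertificateFixedMultiplier : Prop :=
  ∃ f : (UnitAddTorus (Fin 3) → EuclideanSpace ℝ (Fin 3)), Torus.IsSmooth f ∧ Torus.IsDivFree f ∧ Torus.HasZeroMean f ∧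
    ∃ (ε₀ ν₀ : ℝ) (Φ₁ : Torus.CylindricalTest (Fin 3)), 0 < ε₀ ∧ 0 < ν₀ ∧
      ∀ ν : ℝ, 0 < ν → ν < ν₀ → ∃ θ₁ : ℝ, θ₁ ≤ 0 ∧ ∀ u : (Torus.energySpace (Fin 3)), FloorIneq ν f Φ₁ θ₁ ε₀ u

set_option maxHeartbeats 1600000 in
/-- **No frozen multiplier certifies the floor, for any force, whatever the weights** (refutation of
`FloorCertificateFixedMultiplier`). Witness: the INJECTED frozen-multiplier beat. Let `u₀ = Re(e_{k₀} ĉ)`,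
`ĉ = f̂(k₀) ≠ 0` (energy input `(u₀, f) = ‖ĉ‖²`), `W := Φ₁'(u₀)`, `M₁ := (f, W)`. If `M₁ < ε₀` the floor at `u₀`
fails for small `ν` (no self-interaction; the injection signs away ANY weight `θ₁(ν) ≤ 0`). If `M₁ ≥ ε₀` then `W`
has a mode `q ≠ 0`; two waves `Re(e_{(t+1)r} zA) + Re(e_{(t+1)r+q} zB)` escaping along a ray `r ⊥ q`
(`frame_selection`) added to `u₀` leave the coordinates asymptotically unchanged (Riemann–Lebesgue), so
`Φ₁'(u₀ + waves) → W` coefficientwise; of the pair formula only the beat `−πA²|q||ζ|` at `q` survives in the limit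
`t → ∞` — the nine tail terms die by the WEIGHTED Riemann–Lebesgue lemma (`tendsto_tail`; the injected mode makes
some transversal factors grow like `|κ_t|`). With `πA²|q||ζ| ≥ M₁ + 2` the inviscid part of the floor tends to
`≤ −2` while the energy input tends to `‖ĉ‖² > 0`; fix `t`, then `ν` small (upper bounds only): for EVERY
`θ₁ ≤ 0` the floor at the beat state reads `ε₀ ≤ 1/4 − 1 + 1/4`. MORAL: the `ν`-dependence of a witness of
`FloorCertificate` must sit in the multiplier `Φ₁` itself (and by `not_floorCertificateFixedResolution` its
resolution must diverge); re-weighting the energy is worthless. -/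
theorem not_floorCertificateFixedMultiplier : ¬ FloorCertificateFixedMultiplier := by
  rintro ⟨f, hfs, hdiv, hmean, ε₀, ν₀, Φ, hε₀, hν₀, hcert⟩
  have hfi : Integrable f volume := hfs.integrable
  have hF2nn : 0 ≤ ∫ x, ‖f x‖ ^ 2 := integral_nonneg fun x => by positivity
  /- Step 0: the force is nonzero (rest at `ν₀/2`). -/
  have hν₀2 : 0 < ν₀ / 2 := half_pos hν₀
  obtain ⟨θh, hθh, hallh⟩ := hcert (ν₀ / 2) hν₀2 (by linarith)
  have hF2 : 0 < ∫ x, ‖f x‖ ^ 2 := floorFamily_force_ne_zero hfs hε₀ hν₀2 ⟨Φ, θh, hθh, hallh⟩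
  /- Step 1: the injected mode `u₀ = Re(e_{k₀} ĉ)`. -/
  obtain ⟨k₀, hk₀, hck⟩ := exists_fc_ne_zero_of_force hfs hmean hF2
  obtain ⟨ĉ, hĉdef⟩ : ∃ ĉ : (EuclideanSpace ℂ (Fin 3)), ĉ = mFourierCoeff (EuclideanSpace.complexify ∘ f) k₀ := ⟨_, rfl⟩
  rw [← hĉdef] at hck
  obtain ⟨c, hcdef⟩ : ∃ c : ℝ, c = ‖ĉ‖ := ⟨_, rfl⟩
  have hc : 0 < c := by rw [hcdef]; exact norm_pos_iff.2 hck
  have hc2 : 0 < c ^ 2 := by positivity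
  set z₀ : (EuclideanSpace ℂ (Fin 3)) := ((((1 : ℝ)) : ℂ) • ĉ) with hz₀def
  have hdz : ((fun j => ((k₀) j : ℂ)) ⬝ᵥ (WithLp.ofLp (z₀))) = 0 := by
    rw [hz₀def, hĉdef]; exact dotc_injected hfs hdiv k₀ 1
  have hz₀ : ‖z₀‖ = c := by rw [hz₀def, norm_injected zero_le_one ĉ, one_mul, hcdef]
  have hinj : (⟪z₀, mFourierCoeff (EuclideanSpace.complexify ∘ f) k₀⟫_ℂ).re = c ^ 2 := by
    rw [hz₀def, hcdef, hĉdef, injection_value k₀ 1, one_mul]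
  obtain ⟨ue, hue⟩ := exists_state (![k₀] : Fin 1 → (Fin 3 → ℤ)) (![z₀] : Fin 1 → (EuclideanSpace ℂ (Fin 3)))
    (one_ne_zero_gen hk₀) (one_dotc_gen hdz)
  have hWs : Torus.IsSmooth (Φ.grad ue) := isSmooth_grad Φ ue
  obtain ⟨M₁, hM₁def⟩ : ∃ M₁ : ℝ, M₁ = ∫ x, ⟪f x, Φ.grad ue x⟫_ℝ := ⟨_, rfl⟩
  -- energies of the injected mode
  have hsum1 : ∑ m, ‖(![z₀] : Fin 1 → (EuclideanSpace ℂ (Fin 3))) m‖ = c := by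
    simp only [Fin.sum_univ_one, Matrix.cons_val_fin_one]; exact hz₀
  have hint1 : ∫ x, ‖(∑ mm, Torus.realTrigPoly {(![k₀] : Fin 1 → (Fin 3 → ℤ)) mm} (fun _ => (![z₀] : Fin 1 → (EuclideanSpace ℂ (Fin 3))) mm)) x‖ ^ 2 ≤ c ^ 2 := by
    refine integral_norm_sq_modes_le.trans ?_
    rw [hsum1]
  have hpair1 : ∫ x, ⟪(∑ mm, Torus.realTrigPoly {(![k₀] : Fin 1 → (Fin 3 → ℤ)) mm} (fun _ => (![z₀] : Fin 1 → (EuclideanSpace ℂ (Fin 3))) mm)) x, f x⟫_ℝ = c ^ 2 := by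
    rw [integral_inner_modes_left hfi]
    simp only [Fin.sum_univ_one, Matrix.cons_val_fin_one]
    exact hinj
  by_cases hcase : M₁ < ε₀
  · /- Case A: the frozen multiplier does not push enough at `u₀`; `u₀` itself violates the floor. -/
    obtain ⟨E₀, hE₀def⟩ : ∃ E₀ : ℝ, E₀ = (Torus.eGradNormSq ((∑ mm, Torus.realTrigPoly {(![k₀] : Fin 1 → (Fin 3 → ℤ)) mm} (fun _ => (![z₀] : Fin 1 → (EuclideanSpace ℂ (Fin 3))) mm)))).toReal := ⟨_, rfl⟩
    have hE₀ : 0 ≤ E₀ := by rw [hE₀def]; exact ENNReal.toReal_nonneg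
    obtain ⟨Λ₀, hΛ₀def⟩ : ∃ Λ₀ : ℝ, Λ₀ = ∫ x, ⟪(∑ mm, Torus.realTrigPoly {(![k₀] : Fin 1 → (Fin 3 → ℤ)) mm} (fun _ => (![z₀] : Fin 1 → (EuclideanSpace ℂ (Fin 3))) mm)) x, Torus.laplacian (Φ.grad ue) x⟫_ℝ := ⟨_, rfl⟩
    obtain ⟨ν₁, hν₁, hdem⟩ := exists_threshold (a₁ := E₀) (a₂ := E₀) (a₃ := |Λ₀|) (a₄ := c ^ 2)
      (b₁ := (ε₀ - M₁) / 4) (b₂ := c ^ 2 / 2) (b₃ := (ε₀ - M₁) / 4) (b₄ := ∫ x, ‖f x‖ ^ 2)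
      hE₀ hE₀ (abs_nonneg _) (sq_nonneg _) (by linarith) (by positivity) (by linarith) hF2
    have hν : 0 < min ν₁ (min 1 (ν₀ / 2)) := lt_min hν₁ (lt_min one_pos hν₀2)
    have hνν₀ : min ν₁ (min 1 (ν₀ / 2)) < ν₀ :=
      ((min_le_right _ _).trans (min_le_right _ _)).trans_lt (half_lt_self hν₀)
    have hν1 : min ν₁ (min 1 (ν₀ / 2)) ≤ 1 := (min_le_right _ _).trans (min_le_left _ _)
    obtain ⟨hd1, hd2, hd3, hd4⟩ := hdem _ hν (min_le_left _ _)
    obtain ⟨θ, hθ, hall⟩ := hcert _ hν hνν₀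
    generalize min ν₁ (min 1 (ν₀ / 2)) = ν at hν hνν₀ hν1 hd1 hd2 hd3 hd4 hall
    have hfin : Torus.eGradNormSq (((ue : (Torus.energySpace (Fin 3))) : (Lp (EuclideanSpace ℝ (Fin 3)) 2 (volume : Measure (UnitAddTorus (Fin 3))))) : (UnitAddTorus (Fin 3)) → (EuclideanSpace ℝ (Fin 3))) ≠ ⊤ := by
      rw [eGradNormSq_congr_ae' hue]; exact eGradNormSq_modes_ne_top
    have hball : ‖ue‖ ^ 2 ≤ 16 * (∫ x, ‖f x‖ ^ 2) / ν ^ 2 := by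
      rw [norm_sq_of_ae hue, le_div_iff₀ (by positivity)]
      have h1 : (∫ x, ‖(∑ mm, Torus.realTrigPoly {(![k₀] : Fin 1 → (Fin 3 → ℤ)) mm} (fun _ => (![z₀] : Fin 1 → (EuclideanSpace ℂ (Fin 3))) mm)) x‖ ^ 2) * ν ^ 2 ≤ c ^ 2 * ν ^ 2 :=
        mul_le_mul_of_nonneg_right hint1 (sq_nonneg _)
      have h2 : c ^ 2 * ν ^ 2 ≤ c ^ 2 * ν := by
        have : ν ^ 2 ≤ ν := by nlinarith
        exact mul_le_mul_of_nonneg_left this (sq_nonneg _)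
      nlinarith
    have hfl := hall ue hfin hball
    rw [nsGeneratorPairing_of_ae hue, pairing_of_ae hue, eGradNormSq_congr_ae' hue,
      inertial_mode_zero hWs k₀ z₀ hdz, hpair1, ← hM₁def, ← hE₀def, ← hΛ₀def] at hfl
    have hPD : 0 ≤ c ^ 2 - ν * E₀ := by linarith
    have hθterm : 2 * θ * (c ^ 2 - ν * E₀) ≤ 0 := mul_nonpos_of_nonpos_of_nonneg (by linarith) hPD
    have hv2 : ν * Λ₀ ≤ (ε₀ - M₁) / 4 := (mul_le_mul_of_nonneg_left (le_abs_self Λ₀) hν.le).trans hd3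
    linarith
  · /- Case B: the frozen multiplier pushes at `u₀`; the injected escaping beat. -/
    have hM₁ : ε₀ ≤ M₁ := not_lt.1 hcase
    have hM0 : 0 < M₁ := hε₀.trans_le hM₁
    /- Step 2: a nonzero mode `q` of `W = Φ'(u₀)`, the frame `(r, B)` and `ζ ≠ 0`. -/
    obtain ⟨q, hq, hgq⟩ := exists_fc_grad_ne_zero_at Φ ue (f := f) (by rw [← hM₁def]; exact hM0)
    set g : EuclideanSpace ℂ (Fin 3) := mFourierCoeff (EuclideanSpace.complexify ∘ Φ.grad ue) q with hgdef
    have hgt : ((fun j => ((q) j : ℂ)) ⬝ᵥ (WithLp.ofLp (g))) = 0 := dotc_fc_grad Φ ue q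
    obtain ⟨r, B, hr, hrq, -, hB1, hrB, hqB, hgB⟩ := frame_selection hq g hgt
    set ζ : ℂ := ⟪g, EuclideanSpace.complexify B⟫_ℂ with hζdef
    have hζ0 : ζ ≠ 0 := by
      intro h0
      rw [h0, norm_zero] at hgB
      have hg0 : ‖g‖ = 0 := by nlinarith [norm_nonneg g]
      exact hgq (norm_eq_zero.1 hg0)
    have hζn : 0 < ‖ζ‖ := norm_pos_iff.2 hζ0
    have hsq1 : 1 ≤ Real.sqrt (Torus.freqNormSq q) := by
      rw [show (1 : ℝ) = Real.sqrt 1 from Real.sqrt_one.symm]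
      exact Real.sqrt_le_sqrt (Torus.one_le_freqNormSq_of_ne_zero hq)
    /- Step 3: the amplitude `A` with `π A² |q| |ζ| ≥ M₁ + 2`. -/
    set A : ℝ := 1 + (M₁ + 2) / (Real.pi * ‖ζ‖) with hAdef
    have hπζ : 0 < Real.pi * ‖ζ‖ := mul_pos Real.pi_pos hζn
    have hA1 : 1 ≤ A := by
      rw [hAdef]
      have : 0 ≤ (M₁ + 2) / (Real.pi * ‖ζ‖) := div_nonneg (by linarith) hπζ.le
      linarith
    have hA0 : 0 < A := by linarith
    have hgain : M₁ + 2 ≤ Real.pi * A * A * Real.sqrt (Torus.freqNormSq q) * ‖ζ‖ := by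
      have h1 : Real.pi * ‖ζ‖ * A = Real.pi * ‖ζ‖ + (M₁ + 2) := by
        rw [hAdef, mul_add, mul_one, mul_div_cancel₀ _ hπζ.ne']
      have hX : 0 ≤ Real.pi * ‖ζ‖ * A := by positivity
      have h2a : Real.pi * ‖ζ‖ * A ≤ Real.pi * ‖ζ‖ * A * A := by
        nlinarith [mul_nonneg hX (sub_nonneg.2 hA1)]
      have h2b : Real.pi * ‖ζ‖ * A * A ≤ Real.pi * ‖ζ‖ * A * A * Real.sqrt (Torus.freqNormSq q) := by
        nlinarith [mul_nonneg (mul_nonneg hX hA0.le) (sub_nonneg.2 hsq1)]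
      have h3 : Real.pi * ‖ζ‖ * A * A * Real.sqrt (Torus.freqNormSq q) =
          Real.pi * A * A * Real.sqrt (Torus.freqNormSq q) * ‖ζ‖ := by ring
      linarith
    /- The polarisations of the waves. -/
    set zA : EuclideanSpace ℂ (Fin 3) := ((((A) / Real.sqrt (Torus.freqNormSq (q)) : ℝ) : ℂ) • EuclideanSpace.complexify (WithLp.toLp 2 (fun i => ((q) i : ℝ)))) with hzAdef
    set zB : EuclideanSpace ℂ (Fin 3) := (((-Complex.I * conj ((ζ)) * ((‖(ζ)‖⁻¹ : ℝ) : ℂ)) * ((A) : ℂ)) • EuclideanSpace.complexify (B)) with hzBdef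
    have hzA : ‖zA‖ = A := norm_polA hA0.le hq
    have hzB : ‖zB‖ = A := norm_polB A hA0.le hζ0 hB1
    have hqzB : ((fun j => ((q) j : ℂ)) ⬝ᵥ (WithLp.ofLp (zB))) = 0 := by
      rw [hzBdef, dotc_polB, hqB]; simp
    /- Step 4: the ray of injected beat states `u t = u₀ + Re(e_{P t} zA) + Re(e_{P t + q} zB)`. -/
    set P : ℕ → (Fin 3 → ℤ) := fun t => (fun i => (t : ℤ) * r i) + r with hPdef
    have hPzA : ∀ t, ((fun j => ((P t) j : ℂ)) ⬝ᵥ (WithLp.ofLp (zA))) = 0 := fun t => by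
      rw [hzAdef, dotc_polA, show P t ⬝ᵥ q = 0 from ray_dot hrq t]; simp
    have hPzB : ∀ t, ((fun j => ((P t) j : ℂ)) ⬝ᵥ (WithLp.ofLp (zB))) = 0 := fun t => by
      rw [hzBdef, dotc_polB, show (∑ j, ((P t j : ℝ)) * B j) = 0 from ray_sum_mul B hrB t]; simp
    have hPqzB : ∀ t, ((fun j => (((P t + q)) j : ℂ)) ⬝ᵥ (WithLp.ofLp (zB))) = 0 := fun t => by
      rw [hzBdef, dotc_polB, show (∑ j, (((P t + q) j : ℝ)) * B j) = 0 from ray_add_sum_mul B hrB hqB t]; simp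
    have hk : ∀ t, ∀ m, (![k₀, P t, P t + q] : Fin 3 → (Fin 3 → ℤ)) m ≠ 0 := fun t =>
      three_ne_zero_gen hk₀ (ray_ne_zero hr t) (ray_add_ne_zero hq hrq t)
    have hz : ∀ t, ∀ m, ((fun j => (((![k₀, P t, P t + q] : Fin 3 → (Fin 3 → ℤ)) m) j : ℂ)) ⬝ᵥ
        (WithLp.ofLp ((![z₀, zA, zB] : Fin 3 → EuclideanSpace ℂ (Fin 3)) m))) = 0 := fun t =>
      three_dotc_gen hdz (hPzA t) (hPqzB t)
    choose u hu using fun t => exists_state (![k₀, P t, P t + q]) (![z₀, zA, zB]) (hk t) (hz t)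
    /- Step 5: limits along the ray. Coefficients `cᵢ(t) = ∂ᵢφ(coords(u t)) → ∂ᵢφ(coords u₀)`. -/
    set cc : Fin Φ.m → ℕ → ℝ := fun i t => _root_.fderiv ℝ Φ.φ (Φ.coords (u t)) (EuclideanSpace.single i 1) with hccdef
    set cinf : Fin Φ.m → ℝ := fun i => _root_.fderiv ℝ Φ.φ (Φ.coords ue) (EuclideanSpace.single i 1) with hcinfdef
    -- (L1) coordinates converge to those of `u₀`
    have hL1 : ∀ i, Tendsto (fun t => Torus.pairing (((u t : (Torus.energySpace (Fin 3)))) : (Lp (EuclideanSpace ℝ (Fin 3)) 2 (volume : Measure (UnitAddTorus (Fin 3))))) (Φ.g i)) atTop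
        (𝓝 (Torus.pairing (((ue : (Torus.energySpace (Fin 3)))) : (Lp (EuclideanSpace ℝ (Fin 3)) 2 (volume : Measure (UnitAddTorus (Fin 3))))) (Φ.g i))) := by
      intro i
      have h : ∀ t, Torus.pairing (((u t : (Torus.energySpace (Fin 3)))) : (Lp (EuclideanSpace ℝ (Fin 3)) 2 (volume : Measure (UnitAddTorus (Fin 3))))) (Φ.g i) =
          (⟪z₀, mFourierCoeff (EuclideanSpace.complexify ∘ Φ.g i) k₀⟫_ℂ).re +
          ((⟪zA, mFourierCoeff (EuclideanSpace.complexify ∘ Φ.g i) ((fun j => (t : ℤ) * r j) + r)⟫_ℂ).re +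
          (⟪zB, mFourierCoeff (EuclideanSpace.complexify ∘ Φ.g i) ((fun j => (t : ℤ) * r j) + (r + q))⟫_ℂ).re) := by
        intro t
        rw [pairing_of_ae (hu t), integral_inner_modes_left (Φ.g_smooth i).integrable, Fin.sum_univ_three]
        simp only [Matrix.cons_val_zero, Matrix.cons_val_one, Matrix.cons_val_two, Matrix.head_cons, Matrix.tail_cons]
        rw [← ray_add_eq t]
        ring
      have h0 : Torus.pairing (((ue : (Torus.energySpace (Fin 3)))) : (Lp (EuclideanSpace ℝ (Fin 3)) 2 (volume : Measure (UnitAddTorus (Fin 3))))) (Φ.g i) =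
          (⟪z₀, mFourierCoeff (EuclideanSpace.complexify ∘ Φ.g i) k₀⟫_ℂ).re := by
        rw [pairing_of_ae hue, integral_inner_modes_left (Φ.g_smooth i).integrable]
        simp only [Fin.sum_univ_one, Matrix.cons_val_fin_one]
      simp_rw [h]
      rw [h0]
      simpa using ((tendsto_re_inner_fc_ray (Φ.g_smooth i) hr r zA).add
        (tendsto_re_inner_fc_ray (Φ.g_smooth i) hr (r + q) zB)).const_add
          ((⟪z₀, mFourierCoeff (EuclideanSpace.complexify ∘ Φ.g i) k₀⟫_ℂ).re)
    have hcoords : Tendsto (fun t => Φ.coords (u t)) atTop (𝓝 (Φ.coords ue)) := by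
      have hv : Tendsto (fun t => fun i => Torus.pairing (((u t : (Torus.energySpace (Fin 3)))) : (Lp (EuclideanSpace ℝ (Fin 3)) 2 (volume : Measure (UnitAddTorus (Fin 3))))) (Φ.g i)) atTop
          (𝓝 (fun i => Torus.pairing (((ue : (Torus.energySpace (Fin 3)))) : (Lp (EuclideanSpace ℝ (Fin 3)) 2 (volume : Measure (UnitAddTorus (Fin 3))))) (Φ.g i))) :=
        tendsto_pi_nhds.2 fun i => hL1 i
      exact ((PiLp.continuous_toLp 2 (fun _ : Fin Φ.m => ℝ)).tendsto _).comp hv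
    -- (L3) the coefficients converge
    have hL3 : ∀ i, Tendsto (cc i) atTop (𝓝 (cinf i)) := by
      intro i
      have hcont : Continuous fun x : EuclideanSpace ℝ (Fin Φ.m) => _root_.fderiv ℝ Φ.φ x (EuclideanSpace.single i 1) :=
        (Φ.φ_contDiff.continuous_fderiv one_ne_zero).clm_apply continuous_const
      exact (hcont.tendsto _).comp hcoords
    -- (L4) the forcing term `(f, Φ'(u t)) → M₁`
    have hL4 : Tendsto (fun t => ∫ x, ⟪f x, Φ.grad (u t) x⟫_ℝ) atTop (𝓝 M₁) := by
      have h1 : ∀ t, (∫ x, ⟪f x, Φ.grad (u t) x⟫_ℝ) = ∑ i, cc i t * ∫ x, ⟪f x, Φ.g i x⟫_ℝ := fun t =>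
        integral_inner_grad_right Φ hfi (u t)
      have h2 : M₁ = ∑ i, cinf i * ∫ x, ⟪f x, Φ.g i x⟫_ℝ := by
        rw [hM₁def, integral_inner_grad_right Φ hfi ue]
      simp_rw [h1]; rw [h2]
      exact tendsto_finsetSum _ fun i _ => (hL3 i).mul_const _
    -- (L5) the coefficient at the beat frequency converges to `g`, hence the beat converges
    have hL5 : Tendsto (fun t => mFourierCoeff (EuclideanSpace.complexify ∘ Φ.grad (u t)) q) atTop (𝓝 g) := by
      have h1 : ∀ t, mFourierCoeff (EuclideanSpace.complexify ∘ Φ.grad (u t)) q =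
          ∑ i, ((cc i t : ℝ) : ℂ) • mFourierCoeff (EuclideanSpace.complexify ∘ Φ.g i) q := fun t => fc_grad_eq_sum Φ (u t) q
      have h2 : g = ∑ i, ((cinf i : ℝ) : ℂ) • mFourierCoeff (EuclideanSpace.complexify ∘ Φ.g i) q := by
        rw [hgdef, fc_grad_eq_sum Φ ue q]
      simp_rw [h1]; rw [h2]
      exact tendsto_finsetSum _ fun i _ => ((Complex.continuous_ofReal.tendsto _).comp (hL3 i)).smul_const _
    have hbeat : Tendsto (fun t => Real.pi * (conj (((fun j => ((q) j : ℂ)) ⬝ᵥ (WithLp.ofLp (zA)))) *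
        ⟪mFourierCoeff (EuclideanSpace.complexify ∘ Φ.grad (u t)) q, zB⟫_ℂ).im) atTop
        (𝓝 (-(Real.pi * A * A * Real.sqrt (Torus.freqNormSq q) * ‖ζ‖))) := by
      have h := beat_value g hq A A B hζ0
      rw [← h]
      exact ((Complex.continuous_im.tendsto _).comp ((hL5.inner tendsto_const_nhds).const_mul _)).const_mul _
    -- (L6) the nine tail terms tend to zero (weighted Riemann–Lebesgue)
    have hr' : -r ≠ 0 := neg_ne_zero.2 hr
    have hT1 := tendsto_tail Φ u hL3 (fun t => k₀ + P t) hr (c0 := r + k₀)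
      (fun t => by funext i; simp only [hPdef, Pi.add_apply]; ring)
      (fun t => (((fun j => (((k₀ + P t)) j : ℂ)) ⬝ᵥ (WithLp.ofLp (z₀))))) z₀ zA (fun t => norm_dotc_le _ _)
    have hT2 := tendsto_tail Φ u hL3 (fun t => P t - k₀) hr (c0 := r - k₀)
      (fun t => by funext i; simp only [hPdef, Pi.add_apply, Pi.sub_apply]; ring)
      (fun t => conj (((fun j => (((P t - k₀)) j : ℂ)) ⬝ᵥ (WithLp.ofLp (z₀))))) z₀ zA
      (fun t => by rw [Complex.norm_conj]; exact norm_dotc_le _ _)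
    have hT3 := tendsto_tail Φ u hL3 (fun t => k₀ + (P t + q)) hr (c0 := r + q + k₀)
      (fun t => by funext i; simp only [hPdef, Pi.add_apply]; ring)
      (fun t => (((fun j => (((k₀ + (P t + q))) j : ℂ)) ⬝ᵥ (WithLp.ofLp (z₀))))) z₀ zB (fun t => norm_dotc_le _ _)
    have hT4 := tendsto_tail Φ u hL3 (fun t => P t + q - k₀) hr (c0 := r + q - k₀)
      (fun t => by funext i; simp only [hPdef, Pi.add_apply, Pi.sub_apply]; ring)
      (fun t => conj (((fun j => (((P t + q - k₀)) j : ℂ)) ⬝ᵥ (WithLp.ofLp (z₀))))) z₀ zB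
      (fun t => by rw [Complex.norm_conj]; exact norm_dotc_le _ _)
    have hT5 := tendsto_tail Φ u hL3 (fun t => P t + k₀) hr (c0 := r + k₀)
      (fun t => by funext i; simp only [hPdef, Pi.add_apply]; ring)
      (fun t => (((fun j => (((P t + k₀)) j : ℂ)) ⬝ᵥ (WithLp.ofLp (zA))))) zA z₀ (fun t => norm_dotc_le _ _)
    have hT6 := tendsto_tail Φ u hL3 (fun t => k₀ - P t) hr' (c0 := k₀ - r)
      (fun t => by funext i; simp only [hPdef, Pi.add_apply, Pi.sub_apply, Pi.neg_apply]; ring)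
      (fun t => conj (((fun j => (((k₀ - P t)) j : ℂ)) ⬝ᵥ (WithLp.ofLp (zA))))) zA z₀
      (fun t => by rw [Complex.norm_conj]; exact norm_dotc_le _ _)
    have hT9 := tendsto_tail Φ u hL3 (fun t => P t + (P t + q)) (two_ray_ne_zero hr) (c0 := r + r + q)
      (fun t => ray_self_sum t)
      (fun t => (((fun j => (((P t + (P t + q))) j : ℂ)) ⬝ᵥ (WithLp.ofLp (zA))))) zA zB (fun t => norm_dotc_le _ _)
    have hT7 := tendsto_tail Φ u hL3 (fun t => P t + q + k₀) hr (c0 := r + q + k₀)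
      (fun t => by funext i; simp only [hPdef, Pi.add_apply]; ring)
      (fun t => (((fun j => (((P t + q + k₀)) j : ℂ)) ⬝ᵥ (WithLp.ofLp (zB))))) zB z₀ (fun t => norm_dotc_le _ _)
    have hT8 := tendsto_tail Φ u hL3 (fun t => k₀ - (P t + q)) hr' (c0 := k₀ - r - q)
      (fun t => by funext i; simp only [hPdef, Pi.add_apply, Pi.sub_apply, Pi.neg_apply]; ring)
      (fun t => conj (((fun j => (((k₀ - (P t + q))) j : ℂ)) ⬝ᵥ (WithLp.ofLp (zB))))) zB z₀
      (fun t => by rw [Complex.norm_conj]; exact norm_dotc_le _ _)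
    -- (L7) the energy input `(u t, f) → ‖ĉ‖²`
    have hL7 : Tendsto (fun t => ∫ x, ⟪(∑ mm, Torus.realTrigPoly {(![k₀, P t, P t + q] : Fin 3 → (Fin 3 → ℤ)) mm} (fun _ => (![z₀, zA, zB] : Fin 3 → (EuclideanSpace ℂ (Fin 3))) mm)) x, f x⟫_ℝ) atTop (𝓝 (c ^ 2)) := by
      have h : ∀ t, (∫ x, ⟪(∑ mm, Torus.realTrigPoly {(![k₀, P t, P t + q] : Fin 3 → (Fin 3 → ℤ)) mm} (fun _ => (![z₀, zA, zB] : Fin 3 → (EuclideanSpace ℂ (Fin 3))) mm)) x, f x⟫_ℝ) =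
          (⟪z₀, mFourierCoeff (EuclideanSpace.complexify ∘ f) k₀⟫_ℂ).re +
          ((⟪zA, mFourierCoeff (EuclideanSpace.complexify ∘ f) ((fun j => (t : ℤ) * r j) + r)⟫_ℂ).re +
          (⟪zB, mFourierCoeff (EuclideanSpace.complexify ∘ f) ((fun j => (t : ℤ) * r j) + (r + q))⟫_ℂ).re) := by
        intro t
        rw [integral_inner_modes_left hfi, Fin.sum_univ_three]
        simp only [Matrix.cons_val_zero, Matrix.cons_val_one, Matrix.cons_val_two, Matrix.head_cons, Matrix.tail_cons]
        rw [← ray_add_eq t]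
        ring
      simp_rw [h, hinj]
      simpa using ((tendsto_re_inner_fc_ray hfs hr r zA).add (tendsto_re_inner_fc_ray hfs hr (r + q) zB)).const_add (c ^ 2)
    /- The inviscid part of the floor and its limit `≤ -2`. -/
    have hΩ : Tendsto (fun t => (∫ x, ⟪f x, Φ.grad (u t) x⟫_ℝ) +
        (Real.pi * ((((fun j => (((k₀ + P t)) j : ℂ)) ⬝ᵥ (WithLp.ofLp (z₀)))) * ⟪(mFourierCoeff (EuclideanSpace.complexify ∘ Φ.grad (u t)) (k₀ + P t)), zA⟫_ℂ).im +
            Real.pi * (conj (((fun j => (((P t - k₀)) j : ℂ)) ⬝ᵥ (WithLp.ofLp (z₀)))) * ⟪(mFourierCoeff (EuclideanSpace.complexify ∘ Φ.grad (u t)) (P t - k₀)), zA⟫_ℂ).im +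
          (Real.pi * ((((fun j => (((k₀ + (P t + q))) j : ℂ)) ⬝ᵥ (WithLp.ofLp (z₀)))) * ⟪(mFourierCoeff (EuclideanSpace.complexify ∘ Φ.grad (u t)) (k₀ + (P t + q))), zB⟫_ℂ).im +
            Real.pi * (conj (((fun j => (((P t + q - k₀)) j : ℂ)) ⬝ᵥ (WithLp.ofLp (z₀)))) * ⟪(mFourierCoeff (EuclideanSpace.complexify ∘ Φ.grad (u t)) (P t + q - k₀)), zB⟫_ℂ).im) +
        (Real.pi * ((((fun j => (((P t + k₀)) j : ℂ)) ⬝ᵥ (WithLp.ofLp (zA)))) * ⟪(mFourierCoeff (EuclideanSpace.complexify ∘ Φ.grad (u t)) (P t + k₀)), z₀⟫_ℂ).im +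
            Real.pi * (conj (((fun j => (((k₀ - P t)) j : ℂ)) ⬝ᵥ (WithLp.ofLp (zA)))) * ⟪(mFourierCoeff (EuclideanSpace.complexify ∘ Φ.grad (u t)) (k₀ - P t)), z₀⟫_ℂ).im +
          (Real.pi * ((((fun j => (((P t + (P t + q))) j : ℂ)) ⬝ᵥ (WithLp.ofLp (zA)))) * ⟪(mFourierCoeff (EuclideanSpace.complexify ∘ Φ.grad (u t)) (P t + (P t + q))), zB⟫_ℂ).im +
            Real.pi * (conj (((fun j => ((q) j : ℂ)) ⬝ᵥ (WithLp.ofLp (zA)))) * ⟪(mFourierCoeff (EuclideanSpace.complexify ∘ Φ.grad (u t)) q), zB⟫_ℂ).im)) +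
      (Real.pi * ((((fun j => (((P t + q + k₀)) j : ℂ)) ⬝ᵥ (WithLp.ofLp (zB)))) * ⟪(mFourierCoeff (EuclideanSpace.complexify ∘ Φ.grad (u t)) (P t + q + k₀)), z₀⟫_ℂ).im +
        Real.pi * (conj (((fun j => (((k₀ - (P t + q))) j : ℂ)) ⬝ᵥ (WithLp.ofLp (zB)))) * ⟪(mFourierCoeff (EuclideanSpace.complexify ∘ Φ.grad (u t)) (k₀ - (P t + q))), z₀⟫_ℂ).im))) atTop
        (𝓝 (M₁ + ((0 + 0 + (0 + 0)) + (0 + 0 + (0 + -(Real.pi * A * A * Real.sqrt (Torus.freqNormSq q) * ‖ζ‖))) + (0 + 0)))) :=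
      hL4.add ((((hT1.add hT2).add (hT3.add hT4)).add ((hT5.add hT6).add (hT9.add hbeat))).add (hT7.add hT8))
    have hlim : M₁ + ((0 + 0 + (0 + 0)) + (0 + 0 + (0 + -(Real.pi * A * A * Real.sqrt (Torus.freqNormSq q) * ‖ζ‖))) + (0 + 0)) < -1 := by
      linarith
    have hc2 : c ^ 2 / 2 < c ^ 2 := by nlinarith
    obtain ⟨t, ht, ht'⟩ := ((hΩ.eventually (gt_mem_nhds hlim)).and (hL7.eventually (lt_mem_nhds hc2))).exists
    /- Step 6: the floor at `u t` for a small viscosity and ANY weight `θ ≤ 0`. -/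
    have huU := hu t
    have hGs : Torus.IsSmooth (Φ.grad (u t)) := isSmooth_grad Φ (u t)
    have hfin : Torus.eGradNormSq (((u t : (Torus.energySpace (Fin 3))) : (Lp (EuclideanSpace ℝ (Fin 3)) 2 (volume : Measure (UnitAddTorus (Fin 3))))) : (UnitAddTorus (Fin 3) → EuclideanSpace ℝ (Fin 3))) ≠ ⊤ := by
      rw [eGradNormSq_congr_ae' huU]; exact eGradNormSq_modes_ne_top
    have hnormsq : ‖u t‖ ^ 2 ≤ (c + 2 * A) ^ 2 := by
      rw [norm_sq_of_ae huU]
      refine (integral_norm_sq_modes_le).trans ?_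
      have : (∑ m, ‖(![z₀, zA, zB] : Fin 3 → EuclideanSpace ℂ (Fin 3)) m‖) = c + 2 * A := by
        rw [Fin.sum_univ_three]
        change ‖z₀‖ + ‖zA‖ + ‖zB‖ = c + 2 * A
        rw [hz₀, hzA, hzB]; ring
      rw [this]
    -- the viscosity: upper-bound demands only
    obtain ⟨ν₁, hν₁, hdem⟩ := exists_threshold (a₁ := (c + 2 * A) ^ 2)
      (a₂ := (Torus.eGradNormSq (∑ mm, Torus.realTrigPoly {(![k₀, P t, P t + q] : Fin 3 → (Fin 3 → ℤ)) mm} (fun _ => (![z₀, zA, zB] : Fin 3 → (EuclideanSpace ℂ (Fin 3))) mm))).toReal)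
      (a₃ := (Torus.eGradNormSq (∑ mm, Torus.realTrigPoly {(![k₀, P t, P t + q] : Fin 3 → (Fin 3 → ℤ)) mm} (fun _ => (![z₀, zA, zB] : Fin 3 → (EuclideanSpace ℂ (Fin 3))) mm))).toReal)
      (a₄ := |∫ x, ⟪(∑ mm, Torus.realTrigPoly {(![k₀, P t, P t + q] : Fin 3 → (Fin 3 → ℤ)) mm} (fun _ => (![z₀, zA, zB] : Fin 3 → (EuclideanSpace ℂ (Fin 3))) mm)) x, Torus.laplacian (Φ.grad (u t)) x⟫_ℝ|)
      (b₁ := ∫ x, ‖f x‖ ^ 2) (b₂ := 1 / 4) (b₃ := c ^ 2 / 4) (b₄ := 1 / 4)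
      (sq_nonneg _) ENNReal.toReal_nonneg ENNReal.toReal_nonneg (abs_nonneg _) hF2 (by norm_num) (by positivity) (by norm_num)
    have hν : 0 < min ν₁ (min 1 (ν₀ / 2)) := lt_min hν₁ (lt_min one_pos hν₀2)
    have hνν₀ : min ν₁ (min 1 (ν₀ / 2)) < ν₀ :=
      ((min_le_right _ _).trans (min_le_right _ _)).trans_lt (half_lt_self hν₀)
    have hν1 : min ν₁ (min 1 (ν₀ / 2)) ≤ 1 := (min_le_right _ _).trans (min_le_left _ _)
    obtain ⟨hd1, hd2, hd3, hd4⟩ := hdem _ hν (min_le_left _ _)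
    obtain ⟨θ, hθ, hall⟩ := hcert _ hν hνν₀
    generalize min ν₁ (min 1 (ν₀ / 2)) = ν at hν hνν₀ hν1 hd1 hd2 hd3 hd4 hall
    -- the Leray ball
    have hball : ‖u t‖ ^ 2 ≤ 16 * (∫ x, ‖f x‖ ^ 2) / ν ^ 2 := by
      rw [le_div_iff₀ (by positivity)]
      have h1 : ‖u t‖ ^ 2 * ν ^ 2 ≤ (c + 2 * A) ^ 2 * ν ^ 2 := mul_le_mul_of_nonneg_right hnormsq (sq_nonneg _)
      have h2 : (c + 2 * A) ^ 2 * ν ^ 2 ≤ (c + 2 * A) ^ 2 * ν := by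
        have : ν ^ 2 ≤ ν := by nlinarith
        exact mul_le_mul_of_nonneg_left this (sq_nonneg _)
      nlinarith
    -- the FLOOR at `u t`, written on the representative
    have hfl := hall (u t) hfin hball
    rw [nsGeneratorPairing_of_ae huU, pairing_of_ae huU, eGradNormSq_congr_ae' huU,
      inertial_three_exact hGs k₀ (P t) q z₀ zA zB hdz (hPzA t) (hPqzB t) (hPzB t) hqzB] at hfl
    -- name the surviving scalars and conclude by linear arithmetic
    generalize (Torus.eGradNormSq (∑ mm, Torus.realTrigPoly {(![k₀, P t, P t + q] : Fin 3 → (Fin 3 → ℤ)) mm} (fun _ => (![z₀, zA, zB] : Fin 3 → (EuclideanSpace ℂ (Fin 3))) mm))).toReal = E at hfl hd2 hd3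
    generalize (∫ x, ⟪(∑ mm, Torus.realTrigPoly {(![k₀, P t, P t + q] : Fin 3 → (Fin 3 → ℤ)) mm} (fun _ => (![z₀, zA, zB] : Fin 3 → (EuclideanSpace ℂ (Fin 3))) mm)) x, Torus.laplacian (Φ.grad (u t)) x⟫_ℝ) = Λ at hfl hd4
    generalize (∫ x, ⟪(∑ mm, Torus.realTrigPoly {(![k₀, P t, P t + q] : Fin 3 → (Fin 3 → ℤ)) mm} (fun _ => (![z₀, zA, zB] : Fin 3 → (EuclideanSpace ℂ (Fin 3))) mm)) x, f x⟫_ℝ) = Pf at hfl ht'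
    generalize (∫ x, ⟪f x, Φ.grad (u t) x⟫_ℝ) = FG at hfl ht
    generalize (Real.pi * ((((fun j => (((k₀ + P t)) j : ℂ)) ⬝ᵥ (WithLp.ofLp (z₀)))) * ⟪(mFourierCoeff (EuclideanSpace.complexify ∘ Φ.grad (u t)) (k₀ + P t)), zA⟫_ℂ).im +
            Real.pi * (conj (((fun j => (((P t - k₀)) j : ℂ)) ⬝ᵥ (WithLp.ofLp (z₀)))) * ⟪(mFourierCoeff (EuclideanSpace.complexify ∘ Φ.grad (u t)) (P t - k₀)), zA⟫_ℂ).im +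
          (Real.pi * ((((fun j => (((k₀ + (P t + q))) j : ℂ)) ⬝ᵥ (WithLp.ofLp (z₀)))) * ⟪(mFourierCoeff (EuclideanSpace.complexify ∘ Φ.grad (u t)) (k₀ + (P t + q))), zB⟫_ℂ).im +
            Real.pi * (conj (((fun j => (((P t + q - k₀)) j : ℂ)) ⬝ᵥ (WithLp.ofLp (z₀)))) * ⟪(mFourierCoeff (EuclideanSpace.complexify ∘ Φ.grad (u t)) (P t + q - k₀)), zB⟫_ℂ).im) +
        (Real.pi * ((((fun j => (((P t + k₀)) j : ℂ)) ⬝ᵥ (WithLp.ofLp (zA)))) * ⟪(mFourierCoeff (EuclideanSpace.complexify ∘ Φ.grad (u t)) (P t + k₀)), z₀⟫_ℂ).im +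
            Real.pi * (conj (((fun j => (((k₀ - P t)) j : ℂ)) ⬝ᵥ (WithLp.ofLp (zA)))) * ⟪(mFourierCoeff (EuclideanSpace.complexify ∘ Φ.grad (u t)) (k₀ - P t)), z₀⟫_ℂ).im +
          (Real.pi * ((((fun j => (((P t + (P t + q))) j : ℂ)) ⬝ᵥ (WithLp.ofLp (zA)))) * ⟪(mFourierCoeff (EuclideanSpace.complexify ∘ Φ.grad (u t)) (P t + (P t + q))), zB⟫_ℂ).im +
            Real.pi * (conj (((fun j => ((q) j : ℂ)) ⬝ᵥ (WithLp.ofLp (zA)))) * ⟪(mFourierCoeff (EuclideanSpace.complexify ∘ Φ.grad (u t)) q), zB⟫_ℂ).im)) +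
      (Real.pi * ((((fun j => (((P t + q + k₀)) j : ℂ)) ⬝ᵥ (WithLp.ofLp (zB)))) * ⟪(mFourierCoeff (EuclideanSpace.complexify ∘ Φ.grad (u t)) (P t + q + k₀)), z₀⟫_ℂ).im +
        Real.pi * (conj (((fun j => (((k₀ - (P t + q))) j : ℂ)) ⬝ᵥ (WithLp.ofLp (zB)))) * ⟪(mFourierCoeff (EuclideanSpace.complexify ∘ Φ.grad (u t)) (k₀ - (P t + q))), z₀⟫_ℂ).im)) = I at hfl ht
    have hv2 : ν * Λ ≤ 1 / 4 := (mul_le_mul_of_nonneg_left (le_abs_self Λ) hν.le).trans hd4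
    have hPD : 0 ≤ Pf - ν * E := by linarith
    have hθterm : 2 * θ * (Pf - ν * E) ≤ 0 := mul_nonpos_of_nonpos_of_nonneg (by linarith) hPD
    linarith


/-- **What a witness of the crux must look like (the multiplier moves with `ν`).** For every smooth solenoidal
mean-zero force, every `ε₀ > 0` and EVERY cylindrical multiplier `Φ₁` there are arbitrarily small viscosities at
which NO weight `θ₁ ≤ 0` makes `(Φ₁, θ₁)` a floor certificate at level `ε₀`: a witness family `(Φ₁, θ₁)_ν` of
`FloorCertificate` cannot reuse one multiplier along any sequence `ν → 0`. -/
theorem frozen_multiplier_fails {f : (UnitAddTorus (Fin 3) → EuclideanSpace ℝ (Fin 3))} (hfs : Torus.IsSmooth f)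
    (hdiv : Torus.IsDivFree f) (hmean : Torus.HasZeroMean f) {ε₀ : ℝ} (hε₀ : 0 < ε₀)
    (Φ₁ : Torus.CylindricalTest (Fin 3)) {ν₁ : ℝ} (hν₁ : 0 < ν₁) :
    ∃ ν : ℝ, 0 < ν ∧ ν < ν₁ ∧ ∀ θ₁ : ℝ, θ₁ ≤ 0 → ∃ u : (Torus.energySpace (Fin 3)), ¬ FloorIneq ν f Φ₁ θ₁ ε₀ u := by
  by_contra h
  push Not at h
  exact not_floorCertificateFixedMultiplier ⟨f, hfs, hdiv, hmean, ε₀, ν₁, Φ₁, hε₀, hν₁,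
    fun ν hν hνν₁ => by
      obtain ⟨θ₁, hθ₁, hall⟩ := h ν hν hνν₁
      exact ⟨θ₁, hθ₁, hall⟩⟩

/-! ## §G What a witness of the crux must deliver (packaged for the provers) -/

/-- **Witness requirements.** If `FloorCertificate` holds with witness force `f` and budgets `ε₀, ν₀`, then:
(o) `f ≠ 0`; (i) for every `ν < ν₀` EVERY steady weak solution `u ∈ V` of `NS_ν(f)` has `ν‖∇u‖² ≥ ε₀` and
(ii) EVERY stationary statistical solution of `NS_ν(f)` has mean dissipation `≥ ε₀` (weak duality); (iii) for every
degree `N` there is `ν₁ > 0` below which EVERY valid certificate `(Φ₁, θ₁)` for `(f, ε₀, ν)` uses a test field of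
degree `> N` — the resolution of the multipliers is unbounded as `ν → 0`, whatever the weights (injected beat);
(iv) for every cylindrical `Φ₁` there are arbitrarily small `ν` at which NO weight `θ₁ ≤ 0` makes `(Φ₁, θ₁)` valid —
the multiplier itself must move with `ν` (injected frozen-multiplier beat). -/
theorem witness_requirements (h : FloorCertificate) :
    ∃ f : (UnitAddTorus (Fin 3) → EuclideanSpace ℝ (Fin 3)), Torus.IsSmooth f ∧ Torus.IsDivFree f ∧ Torus.HasZeroMean f ∧
      0 < (∫ x, ‖f x‖ ^ 2) ∧ ∃ ε₀ ν₀ : ℝ, 0 < ε₀ ∧ 0 < ν₀ ∧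
      (∀ ν : ℝ, 0 < ν → ν < ν₀ → FloorFamily f ε₀ ν) ∧
      (∀ ν : ℝ, 0 < ν → ν < ν₀ → ∀ u : (Torus.energySpace (Fin 3)),
        (u : (Lp (EuclideanSpace ℝ (Fin 3)) 2 (volume : Measure (UnitAddTorus (Fin 3))))) ∈ Torus.energySpaceV (Fin 3) →
          Torus.IsSteadyWeakSolution ν f u →
            ε₀ ≤ ν * (Torus.eGradNormSq ((u : (Lp (EuclideanSpace ℝ (Fin 3)) 2 (volume : Measure (UnitAddTorus (Fin 3))))) : (UnitAddTorus (Fin 3) → EuclideanSpace ℝ (Fin 3)))).toReal) ∧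
      (∀ ν : ℝ, 0 < ν → ν < ν₀ → ∀ μ : Measure (Torus.energySpace (Fin 3)),
        Torus.IsStationaryStatisticalSolution ν f μ → ε₀ ≤ Torus.ensembleDissipation ν μ) ∧
      (∀ N : ℕ, ∃ ν₁ : ℝ, 0 < ν₁ ∧ ∀ ν : ℝ, 0 < ν → ν ≤ ν₁ →
        ∀ (Φ : Torus.CylindricalTest (Fin 3)) (θ : ℝ), θ ≤ 0 →
          (∀ u : (Torus.energySpace (Fin 3)), FloorIneq ν f Φ θ ε₀ u) → ∃ i, Torus.fourierTruncate N (Φ.g i) ≠ Φ.g i) ∧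
      (∀ (Φ₁ : Torus.CylindricalTest (Fin 3)) (ν₁ : ℝ), 0 < ν₁ →
        ∃ ν : ℝ, 0 < ν ∧ ν < ν₁ ∧ ∀ θ₁ : ℝ, θ₁ ≤ 0 → ∃ u : (Torus.energySpace (Fin 3)), ¬ FloorIneq ν f Φ₁ θ₁ ε₀ u) := by
  obtain ⟨f, hfs, hdiv, hmean, ε₀, ν₀, hε₀, hν₀, hcert⟩ := h
  have hf2 : MemLp f 2 volume := hfs.memLp 2
  refine ⟨f, hfs, hdiv, hmean, ?_, ε₀, ν₀, hε₀, hν₀, hcert, ?_, ?_, ?_, ?_⟩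
  · exact floorFamily_force_ne_zero hfs hε₀ (half_pos hν₀) (hcert (ν₀ / 2) (half_pos hν₀) (by linarith))
  · exact fun ν hν hνν₀ u hV hu => floorFamily_le_dissipation_of_steady hν hf2 (hcert ν hν hνν₀) hV hu
  · exact fun ν hν hνν₀ μ hμ => floorFamily_le_ensembleDissipation hν hf2 (hcert ν hν hνν₀) hμ
  · exact fun N => floor_witness_exceeds_resolution hfs hdiv hmean hε₀ N
  · exact fun Φ₁ ν₁ hν₁ => frozen_multiplier_fails hfs hdiv hmean hε₀ Φ₁ hν₁

/-! ## §H NEAR-MISS (not landed): fixed smooth test FIELDS, free profile and weight -/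

/-- NATURAL STRENGTHENING IV (weaker than `FloorCertificateFixedMultiplier` and than
`FloorCertificateFixedResolution` with `m, g` fixed; the common generalisation of §F and §F′): the test FIELDS
`g₁,…,gₘ` of the multiplier are fixed (smooth, not necessarily trigonometric polynomials), while the profile
`φ = φ_ν` and the weight `θ₁(ν) ≤ 0` are free. -/
def FloorCertificateFixedFields : Prop :=
  ∃ f : (UnitAddTorus (Fin 3) → EuclideanSpace ℝ (Fin 3)), Torus.IsSmooth f ∧ Torus.IsDivFree f ∧ Torus.HasZeroMean f ∧
    ∃ (ε₀ ν₀ : ℝ) (m : ℕ) (g : Fin m → (UnitAddTorus (Fin 3) → EuclideanSpace ℝ (Fin 3)))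
      (hg : ∀ i, Torus.IsSmooth (g i)) (hd : ∀ i, Torus.IsDivFree (g i)) (hz : ∀ i, Torus.HasZeroMean (g i)),
      0 < ε₀ ∧ 0 < ν₀ ∧ ∀ ν : ℝ, 0 < ν → ν < ν₀ →
        ∃ (φ : EuclideanSpace ℝ (Fin m) → ℝ) (hφ : ContDiff ℝ 1 φ) (hc : HasCompactSupport φ) (θ₁ : ℝ), θ₁ ≤ 0 ∧
          ∀ u : (Torus.energySpace (Fin 3)), FloorIneq ν f ⟨m, g, hg, hd, hz, φ, hφ, hc⟩ θ₁ ε₀ u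

/-- **NEAR-MISS (sorried on purpose; NOT a claim of the tree).** `FloorCertificateFixedFields` is false for every
force — PAPER PROOF (this seat, refined after §F′). Order of quantifiers: `f, g` → `ε₀, ν₀` → WE pick `ν` → the
certifier picks `φ_ν, θ_ν` → WE pick `u`. (1) BASIS AND UNIFORM CONSTANTS (before `ν`): extract a maximal linearly
independent subfamily `(g_j)_{j∈J}` (`exists_linearIndependent`); its `L²` Gram matrix is invertible (a smooth field
with zero `L²` norm vanishes). Parametrise directions by unit `β ∈ S^{J}` ↦ `w_β = ∑ β_j g_j ≠ 0`; by compactness of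
the sphere and Fourier uniqueness there is a FINITE set `Q₀` of modes with `max_{q∈Q₀} ‖ŵ_β(q)‖ ≥ κ > 0` uniformly,
hence (`frame_selection`) a finite DESIGN SET of `(q, r, B)` with `|ζ(w_β)| ≥ κ/√2` for every unit `β`; the losses
`(f, w_β)`, `‖Δw_β‖`-pairings are `≤ C(f,g)` uniformly. Fix ONE amplitude `A` with `πA²κ/√2 ≥ C + 1` and ONE escape
parameter `t₁` such that for every design the tail terms of the pair formula (fixed smooth fields `g_j` at
frequencies `k₀ ± P, k₀ ± (P+q), 2P+q`, weighted Riemann–Lebesgue as in `tendsto_tail`) and the GRAM CORRECTION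
`corr = ∑_j β'_j g_j`, `β' = Gram_J⁻¹((waves, g_j))_j = O(A max_j ‖ĝ_j(P)‖)`, contribute `≤ 1/4` in total; then `ν`
small (upper bounds: dissipation of `u₀ + waves_{t₁} − corr ≤ min(1/4, c²/4)`, Laplacian pairings, Leray ball).
(2) AFTER `φ_ν`: let `c* = coords(u₀)`, `W* = ∑ᵢ ∂ᵢφ_ν(c*) gᵢ = ∑_{j∈J} β*_j g_j`. If `β* = 0` the floor at `u₀`
reads `ε₀ ≤ ν‖∇u₀‖²` (injection signs the weight away) — contradiction. Else take the design for `β*/‖β*‖`, the state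
`u = u₀ + waves_{t₁} − corr`: its coordinates equal `c*` EXACTLY (dependent `gᵢ` follow the basis), so
`Φ_ν'(u) = W* = ‖β*‖ w_{β*/‖β*‖}` whatever the stiffness of `φ_ν`, and the floor reads
`ε₀ ≤ ν‖∇u‖² + ‖β*‖·[(f,w) − πA²|q||ζ(w)| + tails + corr-terms + ν(u,Δw)] + 2θ_ν(injection ≥ 0) ≤ 1/4 + ‖β*‖·(−1/4)`,
a contradiction for every `‖β*‖ > 0`. WHY A LIMIT ARGUMENT (as in §F′) DOES NOT SUFFICE: without the exact correction
the coordinates of `u_t` are only asymptotically `c*`, and the modulus of `∇φ_ν` (chosen after `ν`, adversarially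
stiff) would have to be beaten by `t ≤ T(ν)` — impossible; exactness removes `φ_ν` from the estimates entirely.
OBSTRUCTION TO CLOSING IT HERE: formalisation cost only (finite subcover on the coefficient sphere, Gram inverse over a
basis subfamily, mixed mode/smooth-field expansions of the inertial term and of `‖∇·‖²`), ≈ 3× the §F′ development;
no mathematical gap is known to this seat. -/
theorem not_floorCertificateFixedFields : ¬ FloorCertificateFixedFields := by
  sorry

/-! ## §I WHY THE CRUX ITSELF RESISTS (status after cycle 2; no claim)

* What is refuted (all `∀ f`): frozen certificates (§E), frozen multipliers with free weights (§F′), frozen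
  resolution with free weights and profiles (§F). What is demanded of a witness: §G. The certifier's remaining resources per `ν`: resolution `N(ν) → ∞` AND (by the
  sibling crux `KolmogorovFloor`'s disprover, `Cruxes/KolmogorovFloor/Disproof.lean`) either `N(ν) ≳ ν^{-3/4}` or
  weights `|θ₁(ν)| → ∞` — the injected beat shows the weight alone never suffices, the phantom/beat laws show
  bounded weights need Kolmogorov resolution.
* What would kill the crux: for EVERY smooth solenoidal mean-zero `f ≠ 0`, quiet RELAXED stationary statistics of
  `NS_ν(f)` along `ν → 0` (probability measures on the Leray ball with cylindrical Liouville identities and ONE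
  global energy inequality, mean dissipation `→ 0`); by the mean-form minimax of the crux-ideate cards
  (dissipation-deficit-duality ≈ dissipation-tight-minimax ≈ floor-minimax-dissipation-tightness, triaged PASS ×3)
  this is also NECESSARY. Sources of quiet statistics: quiet steady branches (viscous continuation of forced steady
  Euler states — 3-D tool missing; warm sheltered shear branches — toy evidence NEGATIVE, kit j009329/j009988),
  quiet time-averages (= failure of the zeroth law from rest for that `f` — the summit itself).
* Kinematic adversaries are exhausted in this class: any state family chosen before `Φ₁` is priced by a
  multiplier of higher resolution (this file's §F is exactly the statement that finite resolution is what they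
  exploit). A refutation of the crux must therefore be DYNAMICAL (quiet invariant/relaxed measures), i.e. solve the
  inverse-design problem for every force.
* REMARK (weights are useless against INJECTING adversaries; for the sibling cruxes). The only service of the energy
  weight `θ₁ ≤ 0` is at energy-DECREASING states (`(u,f) < ν‖∇u‖²`: pure high-frequency states, far laminar
  states). Every adversary state that injects strictly (`(u,f) > ν‖∇u‖²`) defeats an arbitrary weight for free —
  this is the whole trick of §F/§F′. Consequently every bounded-weight kill in the route's history whose witness
  states inject strictly extends verbatim to FREE weights: e.g. the phantom floor law (truncations `a = P_M v` of
  forced standing flows with `(f, v) > 0`, PHANTOM-FLOOR.md) needs `Θ` only to price `2Θ|(a − v, f)|`, which the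
  strict injection `(a, f) → (f, v) > 0` makes unnecessary for small `ν`; likewise the dressed laminar ray. Planners
  should read `KolmogorovFloor`'s weight bound `−Θ ≤ θ₁` as inessential wherever the adversary injects.
* REMARK (dual reading of §F/§F′ for the minimax cards; informal, NOT a Lean claim). The injected beat kills
  every `W` in the finite-dimensional space `𝒢_N` of band-limited multipliers with a margin linear in `‖W‖`, at
  states sharing their projection `P_N u` (hence their coordinates for EVERY band-limited `Φ`); by Farkas/LP
  duality over `𝒢_N × {θ₁ ≤ 0}` this should upgrade to: for every force, every degree `N` and every small `ν` the
  RELAXED stationarity system truncated to band-limited cylindrical test functionals of degree `≤ N` (plus the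
  global energy inequality) has QUIET solutions — finite mixtures of injected beat states. Read this way, a
  positive proof of the crux must use Liouville identities whose resolution grows with `1/ν`: no fixed finite
  sub-hierarchy of the Hopf equation carries a ν-uniform dissipation floor.
-/

end Summit.AnomalousDissipation.AnomalousDissipation.Cruxes.FloorCertificate.Disproof
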